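import Literature.AlgebraicGeometry.HodgeTheory.HodgeGroupSemisimpleOfNoTypeIVFactor
import Literature.AlgebraicGeometry.Milne1999.BicommutantSemisimple
import Literature.AlgebraicGeometry.Deligne1982.WeilTypeCMHodgeGroupLeSU
import Literature.AlgebraicGeometry.HodgeTheory.WeilClassesMoonenZarhinCriterionHolds
import Mathlib.RingTheory.SimpleModule.IsAlgClosed
import Mathlib.Data.Matrix.Basis
import Mathlib.LinearAlgebra.Trace
import Mathlib.LinearAlgebra.Projection
import Mathlib.RingTheory.Adjoin.Polynomial.Basic
import HarnessLib

/-!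
# No factor of type IV ⟹ every `W_F` consists of Hodge classes (Moonen–Zarhin 1998, §1, second Remark after the
# Criterion), by a trace argument on `End⁰(A) ⊗ ℂ` — and, by the same trace form, «`E ⊂ F′` and `W_{F′}` Hodge ⟹ for any
# other subfield `F`, `W_F` also consists of Hodge classes» (ibid., Remark (1) after Criterion (2))

Layer `Literature/AlgebraicGeometry/HodgeTheory`, theorem-only (no definition, no named fact, no `sorry`).

PRINTED STATEMENT.  B. J. J. Moonen – Yu. G. Zarhin, *Weil classes on abelian varieties*, J. reine angew. Math. 496
(1998) 83–92 = arXiv:alg-geom/9612017 (held text `paper:arxiv-alg-geom_9612017`, chunk p0002, the second Remark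
after the Criterion): «Remark. If all simple factors of `X` are of type 1, 2 or 3 in the Albert classification, then
every subfield `F ⊆ End⁰(X)` satisfies the condition that `n_σ = n_σ′` for all `σ ∈ Σ_F`.  We can see this as follows:
we have an inclusion `Hdg(X) ⊂ Gl_F(V_X)` and `Hdg(X)` acts on `W_F` through the `F`-linear determinant
`det_F : Gl_F(V_X) → Res_{F/ℚ}(𝔾_{m,F})`.  If `X` has no factors of type 4 then the Hodge group `Hdg(X)` is semi-simple
(see [Chi]), hence contained in `Sl_F(V_X)`, which means that `W_F` consists of Hodge classes.»  With the Criterion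
(ibid.): «If `n_σ = n_σ′` for all `σ ∈ Σ_F` then `W_F` consists entirely of Hodge classes».  And Remark (1) after
Criterion (2) (chunk p0004; `E` = the centre of `End⁰(Y)`, `X ∼ Yᵐ`): «Moreover, if `F′ ⊇ E`, then the converse is true.
To see this, let us recall that the center `Z(Hdg)` of the Hodge group is contained in the torus `U_E`, and that the
action of `Hdg` on `W_F` is given by the `F`-linear determinant.  Therefore, if `E ⊂ F′`, then `W_{F′}` consists of Hodge
classes if and only if `Hdg` is semi-simple.  If this holds, then for any other subfield `F ⊆ End⁰(X)`, the space `W_F`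
also consists of Hodge classes.»

RENDERING.  `A` a complex abelian variety (`Motives.AbelianVariety ℂ`); «no factors of type 4» = the tree's
`HodgeTheory.HasNoTypeIVFactor A` (`HodgeTheory/HodgeGroupProductCMFactor`: every element of the centre of
`End⁰(A) = A.endAlgebra` is killed by a non-zero rational polynomial all of whose complex roots are real — the centre is a
product of totally real fields, i.e. no simple factor of Albert type IV); the subfield `F = ℚ(φ)`, `P(φ) = 0` (`P ∈ ℤ[T]`
monic irreducible of degree `e`, `e · r = 2 dim A`), `n_σ = eigenMultiplicity A φ ρ` for `ρ = σ(φ)`, `σ′ ↔ ρ̄`;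
`W_F ⊗ ℂ = weilClassesField A φ P r`; «consists of Hodge classes» = `≤ VanGeemen1994.hodgeClassSpan`; «`E ⊂ F′ = ℚ(φ′)`»
is rendered on `H¹(A(ℂ); ℂ)` as: every CENTRAL pull-back `u^*` (`u^* ∈ C(A) ⊗ ℂ = Milne1999.centralizerAlgebra A`) is a
polynomial in `φ′^*` (`∈ Algebra.adjoin ℂ {φ′^*}`), as in the seat's `WeilClassesFieldHodgeSemisimpleHodgeGroup`.

PROOF ROUTE (a deviation from print, recorded).  The printed proof needs «`Hdg` semisimple ⟹ `Hdg ⊂ Sl_F`», i.e.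
connectedness and the absence of characters of a semisimple group; the tree's Hodge group is Tannaka-free (an abstract
subgroup of `∏ₖ GL(Hᵏ)`) and its «semisimplicity» is rendered as «finite centre» (`HasSemisimpleHodgeGroup`), which does
not give `⊂ Sl_F` directly.  We prove the printed Remark instead by a TRACE ARGUMENT on the finite-dimensional semisimple
`ℂ`-algebra `E″ = Milne1999.bicommutant A ⊆ End_ℂ H¹(A(ℂ); ℂ)` (the `ℂ`-span of the pull-backs `ψ^*`, `= End⁰(A) ⊗ ℂ`
acting; semisimple by the tree's `Milne1999.isSemisimpleRing_bicommutant`):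
* §A (pure algebra) a `K`-linear trace form `τ` on `Π M_{dᵢ}(K)` (`char K = 0`) killing the block identities vanishes
  (elementary matrices), hence a trace form on a finite-dimensional semisimple `ℂ`-algebra that vanishes on the centre
  vanishes identically — Wedderburn–Artin over `ℂ` (Mathlib `IsSemisimpleRing.exists_algEquiv_pi_matrix_of_isAlgClosed`);
* §B (linear algebra) the compression `p ∘ X ∘ ι` of an endomorphism to a complemented subspace `W` it preserves: it is
  multiplicative, so `X ↦ tr(p ∘ X ∘ ι) = tr(X | W)` is a trace form, and on an idempotent it is `dim(XV ∩ W)`;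
* §C (algebra) block scalars: under `e : R ≅ Π M_{dₖ}(ℂ)` a central `z` is `Σₖ νₖ(z) εₖ` with `εₖ = e⁻¹(1ₖ)` the central
  idempotents and `νₖ(z) = (e z k)₀₀`; `z εₘ = νₘ(z) εₘ`; `νₘ(c)² = νₘ(c)` for a central idempotent `c`;
* §D (the carriers) every `X ∈ E″` preserves `H^{1,0}` and `H^{0,1}` and commutes with the Hodge group; the centre of `E″`
  is spanned by CENTRAL pull-backs `u^*` (the tree's `mem_span_pullbackOne_of_commute`: Deligne I Prop. 3.4 + Riemann);
  complex conjugation `conjClass` exchanges `H^{1,0}` and `H^{0,1}` and fixes every `ψ^*`, so every `X ∈ E″` has a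
  conjugate `X̄ ∈ E″` (`conj (X v) = X̄ (conj v)`) with `dim(XH¹ ∩ H^{1,0}) = dim(X̄H¹ ∩ H^{0,1})`; when `A` has no factor
  of type IV the block scalars of a central `u^*` are REAL (they are eigenvalues; the tree's `conj_eigenvalue_pullbackOne`),
  and comparing `u^* εₗ = λₗ εₗ` with its conjugate shows `ε̄ₗ = εₗ` (`conj_blockId_eq_self`), hence
  `tr(εₗ | H^{1,0}) = tr(εₗ | H^{0,1})` and the trace form `τ = tr(· | H^{1,0}) − tr(· | H^{0,1})` vanishes on the centre;
* §E₀/§E so `τ ≡ 0` on `E″` (§A); applied to the spectral projector `π_ρ ∈ E″` onto `V_ρ = ker(φ^* − ρ)` along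
  `⊕_{μ ≠ ρ} V_μ` (it commutes with Milne's `C(A) ⊗ ℂ`), `0 = τ(π_ρ) = dim(V_ρ ∩ H^{1,0}) − dim(V_ρ ∩ H^{0,1}) = n_ρ − n_ρ̄`
  (the ENGINE `eigenMultiplicity_eq_of_forall_center_trace_eq`: `τ` balanced on `Z(E″)` ⟹ `n_ρ = n_ρ̄` for every `φ`).
(For a CM centre — type IV — conjugation permutes the `εₖ` non-trivially and the argument stops, as it must.)
* §F Remark (1) after Criterion (2) through the same engine, bypassing «`Hdg` semi-simple»: under «`E ⊂ F′`» a central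
  `z ∈ Z(E″)` is `q(φ′^*) = Σ_{ρ′} q(ρ′) π′_{ρ′}` (§D: the centre is spanned by central pull-backs; spectral expansion), so
  `τ(z) = Σ_{ρ′} q(ρ′)(n_{ρ′} − n_{ρ̄′}) = 0` when `W_{F′}` is Hodge — and the engine gives `n_ρ = n_ρ̄` for EVERY `φ`.

WHAT IS PROVED (all theorems; the generic §A–§C lemmas and the conjugation bookkeeping are `private` plumbing).
* §A (private) `traceForm_pi_matrix_eq_zero`, `traceForm_eq_zero_of_center`.
* §B (private) `coe_compress_apply_of_mapsTo`, `compress_mul_of_mapsTo`, `trace_compress_mul_comm`,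
  `compress_finset_sum`, `compress_smul`, `trace_compress_eq_finrank_of_isIdempotentElem`.
* §C (private) `apply_eq_smul_one_of_mem_center`, `eq_sum_smul_blockId_of_mem_center`, `blockId_mem_center`,
  `blockId_mul_self`, `blockId_mul_blockId_of_ne`, `blockId_ne_zero`, `mul_blockId_of_mem_center`,
  `blockScalar_mul_self_of_mem_center_of_isIdempotent`.
* §D `map_mem_hodgeOneZero_of_mem_bicommutant`, `map_mem_hodgeZeroOne_of_mem_bicommutant`,
  `commute_hodgeGroup_of_mem_bicommutant`, **`mem_span_central_pullbackOne_of_mem_center`** (the centre of `E″` is spanned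
  by central pull-backs), `exists_conj_of_mem_bicommutant`, `finrank_range_inf_hodgeOneZero_eq_of_conj_apply`,
  `conj_blockScalar_pullbackOne_eq`, **`conj_blockId_eq_self`**, `trace_compress_blockId_hodgeOneZero_eq`,
  **`trace_compress_hodgeOneZero_eq_of_mem_center`** (private: `conj_apply_symm`, `conj_apply_mul`, `eq_of_conj_apply_eq`,
  `isIdempotentElem_of_conj_apply`, `conj_mem_center_of_mem_center`).
* §E₀ (private) `isCompl_eigenspace_iSup_ne`, `projection_mem_bicommutant`, `projection_apply_of_mem_eigenspace`,
  `trace_compress_projection_hodgeOneZero_eq` (`tr(π_ρ | H^{1,0}) = n_ρ`), `trace_compress_projection_hodgeZeroOne_eq`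
  (`= n_ρ̄`), `aeval_pullbackOne_eq_sum_smul_projection` (`q(φ^*) = Σ q(ρ) π_ρ`); public
  **`eigenMultiplicity_eq_of_forall_center_trace_eq`** — THE ENGINE: `tr(z | H^{1,0}) = tr(z | H^{0,1})` for all
  `z ∈ Z(E″)` ⟹ `n_ρ = n_ρ̄` for every `φ` killed by an irreducible `P` and every `ρ`.
* §E **`eigenMultiplicity_eq_of_hasNoTypeIVFactor`** — `HasNoTypeIVFactor A ⟹ n_ρ = n_ρ̄` for every `φ` killed by an
  irreducible `P ∈ ℤ[T]` and every `ρ ∈ ℂ` (the Remark as printed); **`weilClassesField_le_hodgeClassSpan_of_hasNoTypeIVFactor`**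
  — hence `W_F ⊗ ℂ ≤ Bᵐ ⊗ ℂ` (`P` monic irreducible of degree `e`, `e · 2m = 2 dim A`; Criterion (1), the tree's
  `Deligne1982.weilClassesField_le_hodgeClassSpan_iff_forall_eigenMultiplicity_eq`);
  `forall_isOfHodgeType_of_mem_weilClassesField_of_hasNoTypeIVFactor` (class by class, `e · r = 2 dim A`);
  `hodgeGroupOne_le_weilSpecialUnitaryGroupCM_of_hasNoTypeIVFactor` — «`Hdg(X)` … contained in `Sl_F(V_X)`» read on
  `Hg|_{H¹} ≤ SU(φ)(ℂ)` (the tree's `Deligne1982.hodgeGroupOne_le_weilSpecialUnitaryGroupCM_of_forall_eigenMultiplicity_eq`).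
* §F **`trace_compress_hodgeOneZero_eq_of_mem_center_of_adjoin`** — «`E ⊂ F′`» (central pull-backs are polynomials in
  `φ′^*`, `P′(φ′) = 0`, `P′` irreducible) and `n_{ρ′} = n_{ρ̄′}` at the roots of `P′` ⟹ `tr(z | H^{1,0}) = tr(z | H^{0,1})`
  on `Z(E″)`; **`eigenMultiplicity_eq_of_center_le_adjoin`** — Remark (1)'s conclusion: then `n_ρ = n_ρ̄` for EVERY `φ`
  and `ρ`; `weilClassesField_le_hodgeClassSpan_of_center_le_adjoin` (`W_{F′} ⊗ ℂ ≤ B^{m′} ⊗ ℂ ⟹ W_F ⊗ ℂ ≤ Bᵐ ⊗ ℂ`),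
  `forall_isOfHodgeType_of_mem_weilClassesField_of_center_le_adjoin`,
  `hodgeGroupOne_le_weilSpecialUnitaryGroupCM_of_center_le_adjoin`;
  `eigenMultiplicity_eq_of_center_le_adjoin_of_forall_root_im_eq_zero` — `F′ ⊇ E` totally real: the balance of `φ′` is
  automatic; **`eigenMultiplicity_eq_of_center_scalar`**, `weilClassesField_le_hodgeClassSpan_of_center_scalar` — the
  case `E = ℚ` (every central pull-back a scalar; `F′ = ℚ(𝟙)`, `P′ = T − 1`): EVERY `W_F` consists of Hodge classes.

Honesty clause: the second Remark gives «`W_F` consists of Hodge classes» for abelian varieties WITHOUT factors of type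
IV, and §F gives it for ALL `F` once ONE `F′ ⊇ E` has `W_{F′}` Hodge (any type); nothing here is about algebraicity or
decomposability of these classes; the printed intermediate «`Hdg` semi-simple» and its converse are not used here (the
direction «`W_{F′}` Hodge ⟹ finite centre» is the seat's `WeilClassesFieldHodgeSemisimpleHodgeGroup`; «semi-simple ⟹
Hodge» needs the connectedness of the algebraic group `Hdg` and is not claimed).
No `sorry`; axioms `propext`, `Classical.choice`, `Quot.sound`.

## References
* [MoonenZarhin1998WeilClasses] B. J. J. Moonen, Yu. G. Zarhin, *Weil classes on abelian varieties*, J. reine angew.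
  Math. 496 (1998) 83–92 = arXiv:alg-geom/9612017, §1: the Criterion and the second Remark after it (chunk p0002);
  Remark (1) after Criterion (2) (chunk p0004).
* [Deligne1982HodgeCycles] P. Deligne (notes by J. S. Milne), *Hodge cycles on abelian varieties*, LNM 900 (1982), I §3
  Prop. 3.4 (the commutant of the Hodge group).
* [Milne1999LefschetzClasses] J. S. Milne, *Lefschetz classes on abelian varieties*, Duke Math. J. 96 (1999) 639–675, §1
  p. 642 and §2 p. 645 (`End⁰(A) ⊗ k` semisimple; `C(A)`).
* [LangeBirkenhake1992] H. Lange, Ch. Birkenhake, *Complex Abelian Varieties* (1992), §5.5 (Albert types; the centre of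
  `End⁰` is totally real for types I–III, CM for type IV) and §1.2 (the rational representation).
* [VoisinHodgeI2002] C. Voisin, *Hodge Theory and Complex Algebraic Geometry I* (CUP 2002), §6.1.3 Cor. 6.12, Cor. 6.14
  (`H¹ = H^{1,0} ⊕ H^{0,1}`, `H^{0,1} = conj H^{1,0}`).
-/

noncomputable section

open CategoryTheory Polynomial Module Matrix

namespace Literature.AlgebraicGeometry.HodgeTheory

/-! ### §A A trace form on a finite-dimensional semisimple `ℂ`-algebra that kills the centre is zero -/

section TraceForm

variable {ι : Type*} [DecidableEq ι] {d : ι → ℕ} {K : Type*} [Field K]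

/-- `Pi.single` is additive over finite sums (the `AddMonoidHom.single` form). [folklore] -/
private theorem piSingle_finset_sum {β : Type*} (s : Finset β) (i : ι) (f : β → Matrix (Fin (d i)) (Fin (d i)) K) :
    (Pi.single i (∑ b ∈ s, f b) : Π i, Matrix (Fin (d i)) (Fin (d i)) K) = ∑ b ∈ s, Pi.single i (f b) :=
  map_sum (AddMonoidHom.single (fun i => Matrix (Fin (d i)) (Fin (d i)) K) i) f s

/-- Products of elementary elements `(0, …, E_{ab}, …, 0)` of `Π i, M_{dᵢ}(K)`, same middle index. [folklore] -/
private theorem piSingle_single_mul_same (i : ι) (a b c : Fin (d i)) :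
    (Pi.single i (single a b (1 : K)) : Π i, Matrix (Fin (d i)) (Fin (d i)) K) * Pi.single i (single b c (1 : K)) =
      Pi.single i (single a c (1 : K)) := by
  rw [← Pi.single_mul, single_mul_single_same, mul_one]

/-- Products of elementary elements, different middle indices. [folklore] -/
private theorem piSingle_single_mul_of_ne (i : ι) {a b b' c : Fin (d i)} (h : b ≠ b') :
    (Pi.single i (single a b (1 : K)) : Π i, Matrix (Fin (d i)) (Fin (d i)) K) * Pi.single i (single b' c (1 : K)) = 0 := by
  rw [← Pi.single_mul, single_mul_single_of_ne (1 : K) a b b' h, Pi.single_zero]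

/-- **A trace form on `Π i, M_{dᵢ}(K)` (`char K = 0`) which kills the block identities is zero** (the elementary
matrices: `E_{ab} = E_{aa}E_{ab}` and `E_{ab}E_{aa} = 0` for `a ≠ b`; `τ(E_{aa}) = τ(E_{ab}E_{ba}) = τ(E_{bb})` and
`Σ_a E_{aa}` is the block identity). [folklore] -/
private theorem traceForm_pi_matrix_eq_zero [Fintype ι] [CharZero K] (τ : (Π i, Matrix (Fin (d i)) (Fin (d i)) K) →ₗ[K] K)
    (hcomm : ∀ x y, τ (x * y) = τ (y * x)) (hcent : ∀ i, τ (Pi.single i 1) = 0) : τ = 0 := by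
  have hoff : ∀ (i : ι) (a b : Fin (d i)), a ≠ b → τ (Pi.single i (single a b (1 : K))) = 0 := by
    intro i a b hab
    rw [← piSingle_single_mul_same i a a b, hcomm, piSingle_single_mul_of_ne i (Ne.symm hab), map_zero]
  have hdiag : ∀ (i : ι) (a b : Fin (d i)),
      τ (Pi.single i (single a a (1 : K))) = τ (Pi.single i (single b b (1 : K))) := by
    intro i a b
    rw [← piSingle_single_mul_same i a b a, hcomm, piSingle_single_mul_same i b a b]
  have hdiag0 : ∀ (i : ι) (a : Fin (d i)), τ (Pi.single i (single a a (1 : K))) = 0 := by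
    intro i a
    have hsum : (Pi.single i (1 : Matrix (Fin (d i)) (Fin (d i)) K) : Π i, Matrix (Fin (d i)) (Fin (d i)) K) =
        ∑ b : Fin (d i), Pi.single i (single b b (1 : K)) := by
      rw [← sum_single_one, piSingle_finset_sum]
    have h := hcent i
    rw [hsum, map_sum, Finset.sum_congr rfl fun b _ => hdiag i b a, Finset.sum_const, Finset.card_univ,
      Fintype.card_fin, nsmul_eq_mul, mul_eq_zero] at h
    rcases h with h | h
    · have : d i = 0 := by exact_mod_cast h
      exact absurd a.2 (by omega)
    · exact h
  have helem : ∀ (i : ι) (a b : Fin (d i)), τ (Pi.single i (single a b (1 : K))) = 0 := by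
    intro i a b
    by_cases hab : a = b
    · subst hab; exact hdiag0 i a
    · exact hoff i a b hab
  refine LinearMap.ext fun x => ?_
  rw [LinearMap.zero_apply, ← Finset.univ_sum_single x, map_sum]
  refine Finset.sum_eq_zero fun i _ => ?_
  have hxi : (Pi.single i (x i) : Π i, Matrix (Fin (d i)) (Fin (d i)) K) =
      ∑ a, ∑ b, Pi.single i (single a b (x i a b)) := by
    conv_lhs => rw [matrix_eq_sum_single (x i)]
    rw [piSingle_finset_sum]
    exact Finset.sum_congr rfl fun a _ => piSingle_finset_sum _ i _
  rw [hxi, map_sum]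
  refine Finset.sum_eq_zero fun a _ => ?_
  rw [map_sum]
  refine Finset.sum_eq_zero fun b _ => ?_
  have hs : (Pi.single i (single a b (x i a b)) : Π i, Matrix (Fin (d i)) (Fin (d i)) K) =
      x i a b • Pi.single i (single a b (1 : K)) := by
    rw [← Pi.single_smul, smul_single, smul_eq_mul, mul_one]
  rw [hs, map_smul, helem, smul_zero]

/-- **A trace form on a finite-dimensional semisimple `ℂ`-algebra that vanishes on the centre vanishes identically**
(Wedderburn–Artin over the algebraically closed field `ℂ`: `R ≅ Π M_{dᵢ}(ℂ)`, and there every element is a central element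
plus a sum of commutators). [folklore] -/
private theorem traceForm_eq_zero_of_center {R : Type*} [Ring R] [Algebra ℂ R] [IsSemisimpleRing R] [FiniteDimensional ℂ R]
    (τ : R →ₗ[ℂ] ℂ) (hcomm : ∀ x y, τ (x * y) = τ (y * x)) (hcent : ∀ z ∈ Subalgebra.center ℂ R, τ z = 0) :
    τ = 0 := by
  obtain ⟨n, d, hd, ⟨e⟩⟩ := IsSemisimpleRing.exists_algEquiv_pi_matrix_of_isAlgClosed ℂ R
  have h := traceForm_pi_matrix_eq_zero (τ ∘ₗ e.symm.toLinearMap) (fun x y => by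
      simp only [LinearMap.coe_comp, Function.comp_apply, AlgEquiv.toLinearMap_apply, map_mul]
      exact hcomm _ _) (fun i => by
      simp only [LinearMap.coe_comp, Function.comp_apply, AlgEquiv.toLinearMap_apply]
      refine hcent _ (Subalgebra.mem_center_iff.2 fun y => ?_)
      apply e.injective
      rw [map_mul, map_mul, AlgEquiv.apply_symm_apply]
      ext j a b
      by_cases hj : j = i
      · subst hj; simp
      · simp [hj])
  ext x
  have hx := LinearMap.congr_fun h (e x)
  simpa using hx

end TraceForm

/-! ### §B Compression of an endomorphism to a complemented subspace, and its trace -/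

section Compress

variable {K : Type*} [Field K] {V : Type*} [AddCommGroup V] [Module K V]
  {W W' : Submodule K V} (h : IsCompl W W')

/-- **The compression `p ∘ X ∘ ι` of an endomorphism preserving `W` is its restriction**: on `w ∈ W` it is `X w`. [folklore] -/
private theorem coe_compress_apply_of_mapsTo {X : Module.End K V} (hX : ∀ w ∈ W, X w ∈ W) (w : W) :
    ((W.projectionOnto W' h ∘ₗ X ∘ₗ W.subtype) w : V) = X w := by
  rw [LinearMap.comp_apply, LinearMap.comp_apply, Submodule.subtype_apply,
    Submodule.projectionOnto_apply_of_mem_left h (hX w w.2)]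

/-- Compression is multiplicative on endomorphisms preserving `W`. [folklore] -/
private theorem compress_mul_of_mapsTo {X Y : Module.End K V} (hX : ∀ w ∈ W, X w ∈ W) (hY : ∀ w ∈ W, Y w ∈ W) :
    W.projectionOnto W' h ∘ₗ (X * Y) ∘ₗ W.subtype =
      (W.projectionOnto W' h ∘ₗ X ∘ₗ W.subtype) * (W.projectionOnto W' h ∘ₗ Y ∘ₗ W.subtype) := by
  refine LinearMap.ext fun w => Subtype.ext ?_
  rw [coe_compress_apply_of_mapsTo h (X := X * Y) (fun w hw => hX _ (hY w hw)) w, Module.End.mul_apply,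
    Module.End.mul_apply, coe_compress_apply_of_mapsTo h hX, coe_compress_apply_of_mapsTo h hY]

/-- **Cyclicity**: `tr(XY | W) = tr(YX | W)` for endomorphisms preserving `W`. [folklore] -/
private theorem trace_compress_mul_comm {X Y : Module.End K V} (hX : ∀ w ∈ W, X w ∈ W) (hY : ∀ w ∈ W, Y w ∈ W) :
    LinearMap.trace K W (W.projectionOnto W' h ∘ₗ (X * Y) ∘ₗ W.subtype) =
      LinearMap.trace K W (W.projectionOnto W' h ∘ₗ (Y * X) ∘ₗ W.subtype) := by
  rw [compress_mul_of_mapsTo h hX hY, compress_mul_of_mapsTo h hY hX, LinearMap.trace_mul_comm]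

/-- Compression is additive over finite sums of operators. [folklore] -/
private theorem compress_finset_sum {β : Type*} (s : Finset β) (f : β → Module.End K V) :
    W.projectionOnto W' h ∘ₗ (∑ b ∈ s, f b) ∘ₗ W.subtype = ∑ b ∈ s, W.projectionOnto W' h ∘ₗ f b ∘ₗ W.subtype :=
  map_sum ((LinearMap.llcomp K W V W (W.projectionOnto W' h)) ∘ₗ (LinearMap.lcomp K V W.subtype)) f s

/-- Compression is homogeneous. [folklore] -/
private theorem compress_smul (c : K) (X : Module.End K V) :
    W.projectionOnto W' h ∘ₗ (c • X) ∘ₗ W.subtype = c • (W.projectionOnto W' h ∘ₗ X ∘ₗ W.subtype) :=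
  map_smul ((LinearMap.llcomp K W V W (W.projectionOnto W' h)) ∘ₗ (LinearMap.lcomp K V W.subtype)) c X

/-- **The trace of the compression of an idempotent preserving `W` is `dim (range X ∩ W)`.** [folklore] -/
private theorem trace_compress_eq_finrank_of_isIdempotentElem [FiniteDimensional K V] {X : Module.End K V}
    (hXX : IsIdempotentElem X) (hX : ∀ w ∈ W, X w ∈ W) :
    LinearMap.trace K W (W.projectionOnto W' h ∘ₗ X ∘ₗ W.subtype) =
      (finrank K ↥(LinearMap.range X ⊓ W) : K) := by
  set Q := W.projectionOnto W' h ∘ₗ X ∘ₗ W.subtype with hQ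
  have hQQ : IsIdempotentElem Q := by
    change Q * Q = Q
    rw [hQ, ← compress_mul_of_mapsTo h hX hX, hXX.eq]
  have hrange : (LinearMap.range Q).map W.subtype = LinearMap.range X ⊓ W := by
    ext y
    simp only [Submodule.mem_map, LinearMap.mem_range, Submodule.subtype_apply, Submodule.mem_inf]
    constructor
    · rintro ⟨w, ⟨w₀, rfl⟩, rfl⟩
      exact ⟨⟨(w₀ : V), (coe_compress_apply_of_mapsTo h hX w₀).symm⟩, SetLike.coe_mem _⟩
    · rintro ⟨⟨v, rfl⟩, hy⟩
      refine ⟨⟨X v, hy⟩, ⟨⟨X v, hy⟩, Subtype.ext ?_⟩, rfl⟩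
      rw [coe_compress_apply_of_mapsTo h hX]
      exact LinearMap.congr_fun hXX.eq v
  rw [(LinearMap.IsIdempotentElem.isProj_range _ hQQ).trace, ← Submodule.finrank_map_subtype_eq W (LinearMap.range Q),
    hrange]

end Compress

/-! ### §C Block scalars: the centre of `R ≅ Π M_{dₖ}(ℂ)` and its idempotents `εₖ` -/

section Blocks

variable {R : Type*} [Ring R] [Algebra ℂ R] {n : ℕ} {d : Fin n → ℕ} [∀ k, NeZero (d k)]
  (e : R ≃ₐ[ℂ] Π k, Matrix (Fin (d k)) (Fin (d k)) ℂ)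

/-- **A central element is a scalar on each block**: `e z k = (e z k)₀₀ • 1`. [folklore] -/
private theorem apply_eq_smul_one_of_mem_center {z : R} (hz : z ∈ Subalgebra.center ℂ R) (k : Fin n) :
    e z k = (e z k 0 0) • (1 : Matrix (Fin (d k)) (Fin (d k)) ℂ) := by
  have hcomm : ∀ a b : Fin (d k), Commute (single a b (1 : ℂ)) (e z k) := by
    intro a b
    have h1 := Subalgebra.mem_center_iff.1 hz (e.symm (Pi.single k (single a b (1 : ℂ))))
    have h2 := congrArg e h1
    rw [map_mul, map_mul, AlgEquiv.apply_symm_apply] at h2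
    have h3 := congr_fun h2 k
    rw [Pi.mul_apply, Pi.mul_apply, Pi.single_eq_same] at h3
    exact h3
  obtain ⟨c, hc⟩ := mem_range_scalar_of_commute_single (M := e z k) fun a b _ => hcomm a b
  have hc0 : e z k 0 0 = c := by rw [← hc, scalar_apply, diagonal_apply_eq]
  rw [hc0, ← hc, scalar_apply]
  ext a b
  by_cases hab : a = b
  · subst hab; simp
  · simp [hab]

/-- **A central element is the combination `Σₖ (e z k)₀₀ • εₖ` of the block identities `εₖ = e⁻¹(0, …, 1ₖ, …, 0)`.**
[folklore] -/
private theorem eq_sum_smul_blockId_of_mem_center {z : R} (hz : z ∈ Subalgebra.center ℂ R) :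
    z = ∑ k, (e z k 0 0) • e.symm (Pi.single k 1) := by
  apply e.injective
  rw [map_sum]
  funext k
  rw [Finset.sum_apply, Finset.sum_eq_single k (fun k' _ hk' => ?_) (fun hk => absurd (Finset.mem_univ k) hk)]
  · rw [map_smul, AlgEquiv.apply_symm_apply, Pi.smul_apply, Pi.single_eq_same]
    exact apply_eq_smul_one_of_mem_center e hz k
  · rw [map_smul, AlgEquiv.apply_symm_apply, Pi.smul_apply, Pi.single_eq_of_ne (Ne.symm hk'), smul_zero]

omit [∀ k, NeZero (d k)] in
/-- The block identity `εₖ` is central. [folklore] -/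
private theorem blockId_mem_center (k : Fin n) : e.symm (Pi.single k 1) ∈ Subalgebra.center ℂ R := by
  refine Subalgebra.mem_center_iff.2 fun y => ?_
  apply e.injective
  rw [map_mul, map_mul, AlgEquiv.apply_symm_apply]
  ext j a b
  by_cases hj : j = k
  · subst hj; simp
  · simp [hj]

omit [∀ k, NeZero (d k)] in
/-- `εₖ` is an idempotent. [folklore] -/
private theorem blockId_mul_self (k : Fin n) : e.symm (Pi.single k 1) * e.symm (Pi.single k 1) = e.symm (Pi.single k 1) := by
  rw [← map_mul, ← Pi.single_mul, mul_one]

omit [∀ k, NeZero (d k)] in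
/-- `εₖ εₘ = 0` for `k ≠ m`. [folklore] -/
private theorem blockId_mul_blockId_of_ne {k m : Fin n} (hkm : k ≠ m) :
    e.symm (Pi.single k 1) * e.symm (Pi.single m (1 : Matrix (Fin (d m)) (Fin (d m)) ℂ)) = 0 := by
  rw [← map_mul, ← (map_zero e.symm)]
  congr 1
  funext j
  rw [Pi.mul_apply, Pi.zero_apply]
  by_cases hj : j = k
  · subst hj; rw [Pi.single_eq_of_ne hkm, mul_zero]
  · rw [Pi.single_eq_of_ne hj, zero_mul]

/-- `εₖ ≠ 0`. [folklore] -/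
private theorem blockId_ne_zero (k : Fin n) : e.symm (Pi.single k (1 : Matrix (Fin (d k)) (Fin (d k)) ℂ)) ≠ 0 := by
  intro h0
  have h1 : (Pi.single k (1 : Matrix (Fin (d k)) (Fin (d k)) ℂ) : Π k, Matrix (Fin (d k)) (Fin (d k)) ℂ) = 0 := by
    have := congrArg e h0
    rwa [AlgEquiv.apply_symm_apply, map_zero] at this
  have h2 := congr_fun h1 k
  rw [Pi.single_eq_same, Pi.zero_apply] at h2
  have h3 := congr_fun (congr_fun h2 0) 0
  simp at h3

/-- **A central element times `εₘ` is `(e z m)₀₀ • εₘ`.** [folklore] -/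
private theorem mul_blockId_of_mem_center {z : R} (hz : z ∈ Subalgebra.center ℂ R) (m : Fin n) :
    z * e.symm (Pi.single m 1) = (e z m 0 0) • e.symm (Pi.single m 1) := by
  apply e.injective
  rw [map_mul, map_smul, AlgEquiv.apply_symm_apply]
  funext j
  rw [Pi.mul_apply, Pi.smul_apply]
  by_cases hj : j = m
  · subst hj
    rw [Pi.single_eq_same, mul_one]
    exact apply_eq_smul_one_of_mem_center e hz j
  · rw [Pi.single_eq_of_ne hj, mul_zero, smul_zero]

/-- For a central idempotent `c`, each block scalar is `0` or `1`: `ν² = ν`. [folklore] -/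
private theorem blockScalar_mul_self_of_mem_center_of_isIdempotent {c : R} (hc : c ∈ Subalgebra.center ℂ R)
    (hcc : c * c = c) (m : Fin n) : e c m 0 0 * e c m 0 0 = e c m 0 0 := by
  have h := congrArg (fun x => e x m) hcc
  simp only [map_mul, Pi.mul_apply] at h
  rw [apply_eq_smul_one_of_mem_center e hc m, smul_mul_smul_comm, mul_one] at h
  have h' := congr_fun (congr_fun h 0) 0
  simpa using h'

end Blocks

/-! ### §D Complex conjugation, the Hodge pieces and the algebra `E″ = bicommutant A` on `H¹(A(ℂ); ℂ)` -/

open Literature.AlgebraicTopology.SingularHomology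
open Literature.AlgebraicGeometry.Motives
open Literature.AlgebraicGeometry.VanGeemen1994 (pullbackOne hodgeClassSpan detOnEigenspace hodgeGroupOne)
open Literature.AlgebraicGeometry.Milne1999 (bicommutant centralizerAlgebra pullbackOne_mem_bicommutant
  mem_bicommutant_iff_mem_span isSemisimpleRing_bicommutant mem_centralizerAlgebra_iff')

section Carrier

variable {A : AbelianVariety ℂ} (hA : IsSmoothProjective A.dim A.X)

/-- **Every `X ∈ E″` preserves `H^{1,0}`** (`E″` is the span of the `ψ^*`, which preserve Hodge types).
[cite: VoisinHodgeI2002, §7.3.2] [cite: Milne1999LefschetzClasses, §1 Remark 1.2 (p. 643)] -/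
theorem map_mem_hodgeOneZero_of_mem_bicommutant {X : Module.End ℂ (complexBetti A.X 1)} (hX : X ∈ bicommutant A)
    {x : complexBetti A.X 1} (hx : x ∈ hodgeOneZero hA) : X x ∈ hodgeOneZero hA := by
  rw [mem_bicommutant_iff_mem_span] at hX
  induction hX using Submodule.span_induction with
  | mem X h =>
    obtain ⟨φ, rfl⟩ := h
    exact map_mem_hodgeOneZero hA φ.hom.hom.hom hx
  | zero => rw [LinearMap.zero_apply]; exact Submodule.zero_mem _
  | add X Y _ _ hX hY => rw [LinearMap.add_apply]; exact Submodule.add_mem _ hX hY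
  | smul c X _ hX => rw [LinearMap.smul_apply]; exact Submodule.smul_mem _ c hX

/-- **Every `X ∈ E″` preserves `H^{0,1}`.** [cite: VoisinHodgeI2002, §7.3.2] -/
theorem map_mem_hodgeZeroOne_of_mem_bicommutant {X : Module.End ℂ (complexBetti A.X 1)} (hX : X ∈ bicommutant A)
    {x : complexBetti A.X 1} (hx : x ∈ hodgeZeroOne hA) : X x ∈ hodgeZeroOne hA := by
  rw [mem_bicommutant_iff_mem_span] at hX
  induction hX using Submodule.span_induction with
  | mem X h =>
    obtain ⟨φ, rfl⟩ := h
    exact map_mem_hodgeZeroOne hA φ.hom.hom.hom hx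
  | zero => rw [LinearMap.zero_apply]; exact Submodule.zero_mem _
  | add X Y _ _ hX hY => rw [LinearMap.add_apply]; exact Submodule.add_mem _ hX hY
  | smul c X _ hX => rw [LinearMap.smul_apply]; exact Submodule.smul_mem _ c hX

/-- **Every `X ∈ E″` commutes with the Hodge group on `H¹`** (each `ψ^*` does, the tree's `pullbackOne_commute_hodgeGroup`).
[cite: Deligne1982HodgeCycles, I §3 Prop. 3.4] -/
theorem commute_hodgeGroup_of_mem_bicommutant {X : Module.End ℂ (complexBetti A.X 1)} (hX : X ∈ bicommutant A) :
    ∀ g ∈ hodgeGroup A.dim A.X, ∀ y : complexBetti A.X 1, X (g 1 y) = g 1 (X y) := by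
  intro g hg y
  rw [mem_bicommutant_iff_mem_span] at hX
  induction hX using Submodule.span_induction generalizing y with
  | mem X h =>
    obtain ⟨φ, rfl⟩ := h
    exact HodgeGroupSemisimple.pullbackOne_commute_hodgeGroup φ g hg y
  | zero => rw [LinearMap.zero_apply, LinearMap.zero_apply, map_zero]
  | add X Y _ _ hX hY => rw [LinearMap.add_apply, LinearMap.add_apply, map_add, hX, hY]
  | smul c X _ hX => rw [LinearMap.smul_apply, LinearMap.smul_apply, map_smul, hX]

/-- **The centre of `E″` is spanned by CENTRAL pull-backs `u^*`** (`u^* ∈ C(A) ⊗ ℂ`): a central element of `E″` commutes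
with every `ψ^*` and with the Hodge group, so the tree's `mem_span_pullbackOne_of_commute` (Deligne I Prop. 3.4 +
Riemann, with the Galois-stable centraliser condition) applies. [cite: Deligne1982HodgeCycles, I §3 Prop. 3.4]
[cite: Milne1999LefschetzClasses, §2 p. 645] -/
theorem mem_span_central_pullbackOne_of_mem_center {z : ↥(bicommutant A)}
    (hz : z ∈ Subalgebra.center ℂ ↥(bicommutant A)) :
    (z : Module.End ℂ (complexBetti A.X 1)) ∈ Submodule.span ℂ {Y : Module.End ℂ (complexBetti A.X 1) |
      ∃ u : A ⟶ A, Y = pullbackOne A u ∧ pullbackOne A u ∈ centralizerAlgebra A} := by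
  refine HodgeGroupSemisimple.mem_span_pullbackOne_of_commute A z (commute_hodgeGroup_of_mem_bicommutant z.2) ?_
  intro φ y
  have h := Subalgebra.mem_center_iff.1 hz ⟨pullbackOne A φ, pullbackOne_mem_bicommutant φ⟩
  have h' := congrArg (fun w : ↥(bicommutant A) => (w : Module.End ℂ (complexBetti A.X 1))) h
  rw [Subalgebra.coe_mul, Subalgebra.coe_mul] at h'
  have h'' := LinearMap.congr_fun h' y
  rw [Module.End.mul_apply, Module.End.mul_apply] at h''
  exact h''.symm

/-! #### Conjugates -/

/-- **Every `X ∈ E″` has a complex conjugate `X̄ ∈ E″`**: `conj (X v) = X̄ (conj v)` (`ψ^*` is real — `conjClass_map` —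
and `E″` is the `ℂ`-span of the `ψ^*`). [cite: VoisinHodgeI2002, §6.1.3 Cor. 6.12] -/
theorem exists_conj_of_mem_bicommutant {X : Module.End ℂ (complexBetti A.X 1)} (hX : X ∈ bicommutant A) :
    ∃ Y ∈ bicommutant A, ∀ v, conjClass (ComplexPoints A.X) 1 (X v) = Y (conjClass (ComplexPoints A.X) 1 v) := by
  rw [mem_bicommutant_iff_mem_span] at hX
  induction hX using Submodule.span_induction with
  | mem X h =>
    obtain ⟨φ, rfl⟩ := h
    exact ⟨pullbackOne A φ, pullbackOne_mem_bicommutant φ, fun v => conjClass_map _ v⟩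
  | zero =>
    refine ⟨0, Subalgebra.zero_mem _, fun v => ?_⟩
    rw [LinearMap.zero_apply, LinearMap.zero_apply, conjClass_zero]
  | add X X' _ _ hX hX' =>
    obtain ⟨Y, hY, h⟩ := hX
    obtain ⟨Y', hY', h'⟩ := hX'
    refine ⟨Y + Y', Subalgebra.add_mem _ hY hY', fun v => ?_⟩
    rw [LinearMap.add_apply, conjClass_add, h, h', LinearMap.add_apply]
  | smul c X _ hX =>
    obtain ⟨Y, hY, h⟩ := hX
    refine ⟨starRingEnd ℂ c • Y, Subalgebra.smul_mem _ hY _, fun v => ?_⟩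
    rw [LinearMap.smul_apply, conjClass_smul, h, LinearMap.smul_apply]

variable {X Y : Module.End ℂ (complexBetti A.X 1)}

/-- The conjugacy relation is symmetric (`conj` is an involution). [folklore] -/
private theorem conj_apply_symm (hXY : ∀ v, conjClass (ComplexPoints A.X) 1 (X v) = Y (conjClass (ComplexPoints A.X) 1 v))
    (v : complexBetti A.X 1) : conjClass (ComplexPoints A.X) 1 (Y v) = X (conjClass (ComplexPoints A.X) 1 v) := by
  have h := hXY (conjClass (ComplexPoints A.X) 1 v)
  rw [conjClass_conjClass] at h
  rw [← h, conjClass_conjClass]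

/-- Conjugates of products are products of conjugates. [folklore] -/
private theorem conj_apply_mul {X' Y' : Module.End ℂ (complexBetti A.X 1)}
    (hXY : ∀ v, conjClass (ComplexPoints A.X) 1 (X v) = Y (conjClass (ComplexPoints A.X) 1 v))
    (hXY' : ∀ v, conjClass (ComplexPoints A.X) 1 (X' v) = Y' (conjClass (ComplexPoints A.X) 1 v))
    (v : complexBetti A.X 1) : conjClass (ComplexPoints A.X) 1 ((X * X') v) = (Y * Y') (conjClass (ComplexPoints A.X) 1 v) := by
  rw [Module.End.mul_apply, Module.End.mul_apply, hXY, hXY']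

/-- Two endomorphisms with the same conjugate partner agree (`conj` is surjective). [folklore] -/
private theorem eq_of_conj_apply_eq {Y' : Module.End ℂ (complexBetti A.X 1)}
    (hXY : ∀ v, conjClass (ComplexPoints A.X) 1 (X v) = Y (conjClass (ComplexPoints A.X) 1 v))
    (hXY' : ∀ v, conjClass (ComplexPoints A.X) 1 (X v) = Y' (conjClass (ComplexPoints A.X) 1 v)) : Y = Y' := by
  refine LinearMap.ext fun w => ?_
  have h1 := hXY (conjClass (ComplexPoints A.X) 1 w)
  have h2 := hXY' (conjClass (ComplexPoints A.X) 1 w)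
  rw [conjClass_conjClass] at h1 h2
  rw [← h1, ← h2]

/-- The conjugate of an idempotent is an idempotent. [folklore] -/
private theorem isIdempotentElem_of_conj_apply (hXX : IsIdempotentElem X)
    (hXY : ∀ v, conjClass (ComplexPoints A.X) 1 (X v) = Y (conjClass (ComplexPoints A.X) 1 v)) :
    IsIdempotentElem Y := by
  have h := eq_of_conj_apply_eq (conj_apply_mul hXY hXY) (X := X * X) (by rw [hXX.eq]; exact hXY)
  exact h

/-- **The conjugate of a CENTRAL element of `E″` is central** (conjugate the relation `X Z̃ = Z̃ X` for the conjugate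
`Z̃ ∈ E″` of any `Z ∈ E″`). [folklore] -/
private theorem conj_mem_center_of_mem_center {Xc Yc : ↥(bicommutant A)} (hXc : Xc ∈ Subalgebra.center ℂ ↥(bicommutant A))
    (hXY : ∀ v, conjClass (ComplexPoints A.X) 1 ((Xc : Module.End ℂ (complexBetti A.X 1)) v) =
      (Yc : Module.End ℂ (complexBetti A.X 1)) (conjClass (ComplexPoints A.X) 1 v)) :
    Yc ∈ Subalgebra.center ℂ ↥(bicommutant A) := by
  refine Subalgebra.mem_center_iff.2 fun Z => ?_
  obtain ⟨Zt, hZt, hZ⟩ := exists_conj_of_mem_bicommutant Z.2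
  -- `X` commutes with `Z̃`
  have hcomm := Subalgebra.mem_center_iff.1 hXc ⟨Zt, hZt⟩
  have hcomm' := congrArg Subtype.val hcomm
  rw [Subalgebra.coe_mul] at hcomm'
  -- conjugate both sides
  rw [Subalgebra.coe_mul] at hcomm'
  apply Subtype.ext
  rw [Subalgebra.coe_mul, Subalgebra.coe_mul]
  have hZ' : ∀ v, conjClass (ComplexPoints A.X) 1 (Zt v) = (Z : Module.End ℂ (complexBetti A.X 1))
      (conjClass (ComplexPoints A.X) 1 v) := conj_apply_symm hZ
  have hXY₁ := conj_apply_mul hZ' hXY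
  have hXY₂ : ∀ v, conjClass (ComplexPoints A.X) 1 ((Zt * (Xc : Module.End ℂ (complexBetti A.X 1))) v) =
      ((Yc : Module.End ℂ (complexBetti A.X 1)) * (Z : Module.End ℂ (complexBetti A.X 1)))
        (conjClass (ComplexPoints A.X) 1 v) := by
    rw [hcomm']
    exact conj_apply_mul hXY hZ'
  exact eq_of_conj_apply_eq hXY₁ hXY₂

/-- **Conjugation exchanges `XH¹ ∩ H^{1,0}` and `X̄H¹ ∩ H^{0,1}`**, so they have the same dimension.
[cite: VoisinHodgeI2002, §6.1.3 Cor. 6.12] -/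
theorem finrank_range_inf_hodgeOneZero_eq_of_conj_apply
    (hXY : ∀ v, conjClass (ComplexPoints A.X) 1 (X v) = Y (conjClass (ComplexPoints A.X) 1 v)) :
    finrank ℂ ↥(LinearMap.range X ⊓ hodgeOneZero hA) = finrank ℂ ↥(LinearMap.range Y ⊓ hodgeZeroOne hA) := by
  haveI := finite_complexBetti_abelianVariety A 1
  refine finrank_eq_of_conjClass_mapsTo _ _ (fun x hx => ?_) (fun x hx => ?_)
  · obtain ⟨⟨w, rfl⟩, hx⟩ := hx
    exact ⟨⟨conjClass (ComplexPoints A.X) 1 w, (hXY w).symm⟩, conjClass_mem_hodgeZeroOne hA hx⟩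
  · obtain ⟨⟨w, rfl⟩, hx⟩ := hx
    exact ⟨⟨conjClass (ComplexPoints A.X) 1 w, (conj_apply_symm hXY w).symm⟩, conjClass_mem_hodgeOneZero hA hx⟩

/-! #### No factor of type IV: conjugation fixes the central idempotents of `E″` -/

variable {n : ℕ} {d : Fin n → ℕ} [∀ k, NeZero (d k)]
  (e : ↥(bicommutant A) ≃ₐ[ℂ] Π k, Matrix (Fin (d k)) (Fin (d k)) ℂ)

/-- **A central pull-back with real eigenvalues has real block scalars**: for `u^* ∈ C(A) ⊗ ℂ` (central in `E″`) the
scalar `(e u^* k)₀₀` by which it acts on the `k`-th block is an eigenvalue of `u^*` on `H¹` (the block identity `εₖ` is a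
non-zero endomorphism), hence real when `A` has no factor of type IV (the tree's `conj_eigenvalue_pullbackOne`).
[cite: MoonenZarhin1998WeilClasses, §1 second Remark after the Criterion] [cite: LangeBirkenhake1992, §5.5] -/
theorem conj_blockScalar_pullbackOne_eq (hA4 : HasNoTypeIVFactor A) (u : A ⟶ A)
    (huC : pullbackOne A u ∈ centralizerAlgebra A) (k : Fin n) :
    starRingEnd ℂ (e ⟨pullbackOne A u, pullbackOne_mem_bicommutant u⟩ k 0 0) =
      e ⟨pullbackOne A u, pullbackOne_mem_bicommutant u⟩ k 0 0 := by
  set U : ↥(bicommutant A) := ⟨pullbackOne A u, pullbackOne_mem_bicommutant u⟩ with hU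
  -- `U` is central in `E″`
  have hUc : U ∈ Subalgebra.center ℂ ↥(bicommutant A) := by
    refine Subalgebra.mem_center_iff.2 fun Z => Subtype.ext ?_
    rw [Subalgebra.coe_mul, Subalgebra.coe_mul]
    have hZ : (Z : Module.End ℂ (complexBetti A.X 1)) ∈ bicommutant A := Z.2
    exact ((Subalgebra.mem_centralizer_iff ℂ).1 hZ (pullbackOne A u) huC).symm
  -- a non-zero vector in the `k`-th block
  have hε0 : (e.symm (Pi.single k 1) : Module.End ℂ (complexBetti A.X 1)) ≠ 0 := by
    intro h0
    exact blockId_ne_zero e k (Subtype.ext h0)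
  obtain ⟨v, hv⟩ : ∃ v, (e.symm (Pi.single k 1) : Module.End ℂ (complexBetti A.X 1)) v ≠ 0 := by
    by_contra hall
    push Not at hall
    exact hε0 (LinearMap.ext hall)
  -- it is an eigenvector of `u^*` with eigenvalue the block scalar
  have hUε := mul_blockId_of_mem_center e hUc k
  have heig : pullbackOne A u ((e.symm (Pi.single k 1) : Module.End ℂ (complexBetti A.X 1)) v) =
      (e U k 0 0) • (e.symm (Pi.single k 1) : Module.End ℂ (complexBetti A.X 1)) v := by
    have h := congrArg Subtype.val hUε
    rw [Subalgebra.coe_mul, Subalgebra.coe_smul] at h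
    have h' := LinearMap.congr_fun h v
    rw [Module.End.mul_apply, LinearMap.smul_apply] at h'
    exact h'
  exact HodgeGroupSemisimple.conj_eigenvalue_pullbackOne hA4 u huC hv heig

/-- **No factor of type IV ⟹ conjugation fixes every central primitive idempotent `εₗ` of `E″`.**  Let `c ∈ E″` be the
conjugate of `εₗ`; it is a central idempotent, `c = Σₘ νₘ εₘ` with `νₘ ∈ {0, 1}`.  For a central pull-back `u^* = Σ λₖ εₖ`
(`λₖ` real, `u^*` real) conjugating `u^* εₗ = λₗ εₗ` gives `u^* c = λₗ c`, so `λₘ = λₗ` whenever `νₘ = 1`; as the centre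
is spanned by such `u^*`, every central element has equal `l`- and `m`-scalars — applied to `εₗ` itself, `m = l`.
[cite: MoonenZarhin1998WeilClasses, §1 second Remark after the Criterion] [cite: LangeBirkenhake1992, §5.5] -/
theorem conj_blockId_eq_self (hA4 : HasNoTypeIVFactor A) (l : Fin n) {c : ↥(bicommutant A)}
    (hc : ∀ v, conjClass (ComplexPoints A.X) 1 ((e.symm (Pi.single l 1) : Module.End ℂ (complexBetti A.X 1)) v) =
      (c : Module.End ℂ (complexBetti A.X 1)) (conjClass (ComplexPoints A.X) 1 v)) :
    c = e.symm (Pi.single l 1) := by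
  -- `c` is a central idempotent
  have hcc : c ∈ Subalgebra.center ℂ ↥(bicommutant A) := conj_mem_center_of_mem_center (blockId_mem_center e l) hc
  have hεε : IsIdempotentElem ((e.symm (Pi.single l 1) : ↥(bicommutant A)) : Module.End ℂ (complexBetti A.X 1)) := by
    have h := congrArg Subtype.val (blockId_mul_self e l)
    rw [Subalgebra.coe_mul] at h
    exact h
  have hci : c * c = c := by
    have h : IsIdempotentElem (c : Module.End ℂ (complexBetti A.X 1)) := isIdempotentElem_of_conj_apply hεε hc
    apply Subtype.ext
    rw [Subalgebra.coe_mul]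
    exact h.eq
  -- key step: every `m` with `νₘ ≠ 0` equals `l`
  have key : ∀ m : Fin n, e c m 0 0 ≠ 0 → m = l := by
    intro m hm
    have hνm : e c m 0 0 = 1 := by
      have h := blockScalar_mul_self_of_mem_center_of_isIdempotent e hcc hci m
      rcases mul_eq_zero.1 (show e c m 0 0 * (e c m 0 0 - 1) = 0 by rw [mul_sub, mul_one, h, sub_self]) with h0 | h1
      · exact absurd h0 hm
      · exact sub_eq_zero.1 h1
    -- `c εₘ = εₘ`
    have hcε : c * e.symm (Pi.single m 1) = e.symm (Pi.single m 1) := by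
      rw [mul_blockId_of_mem_center e hcc m, hνm, one_smul]
    -- every central pull-back has equal `l`- and `m`-scalars
    have hpull : ∀ u : A ⟶ A, pullbackOne A u ∈ centralizerAlgebra A →
        e ⟨pullbackOne A u, pullbackOne_mem_bicommutant u⟩ l 0 0 =
          e ⟨pullbackOne A u, pullbackOne_mem_bicommutant u⟩ m 0 0 := by
      intro u huC
      set U : ↥(bicommutant A) := ⟨pullbackOne A u, pullbackOne_mem_bicommutant u⟩ with hU
      have hUc : U ∈ Subalgebra.center ℂ ↥(bicommutant A) := by
        refine Subalgebra.mem_center_iff.2 fun Z => Subtype.ext ?_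
        rw [Subalgebra.coe_mul, Subalgebra.coe_mul]
        exact ((Subalgebra.mem_centralizer_iff ℂ).1 Z.2 (pullbackOne A u) huC).symm
      have hreal : ∀ k, starRingEnd ℂ (e U k 0 0) = e U k 0 0 := fun k => conj_blockScalar_pullbackOne_eq e hA4 u huC k
      -- `U εₗ = λₗ εₗ`, conjugated: `U c = λₗ c`
      have h1 : U * e.symm (Pi.single l 1) = (e U l 0 0) • e.symm (Pi.single l 1) := mul_blockId_of_mem_center e hUc l
      have hUreal : ∀ v, conjClass (ComplexPoints A.X) 1 ((U : Module.End ℂ (complexBetti A.X 1)) v) =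
          (U : Module.End ℂ (complexBetti A.X 1)) (conjClass (ComplexPoints A.X) 1 v) := fun v => conjClass_map _ v
      have h1' : (U : Module.End ℂ (complexBetti A.X 1)) * ((e.symm (Pi.single l 1) : ↥(bicommutant A)) :
          Module.End ℂ (complexBetti A.X 1)) = (e U l 0 0) • ((e.symm (Pi.single l 1) : ↥(bicommutant A)) :
          Module.End ℂ (complexBetti A.X 1)) := by
        have h := congrArg Subtype.val h1
        rw [Subalgebra.coe_mul, Subalgebra.coe_smul] at h
        exact h
      have h2 : (U : Module.End ℂ (complexBetti A.X 1)) * (c : Module.End ℂ (complexBetti A.X 1)) =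
          (e U l 0 0) • (c : Module.End ℂ (complexBetti A.X 1)) := by
        have hX₁ := conj_apply_mul hUreal hc
        have hX₂ : ∀ v, conjClass (ComplexPoints A.X) 1 (((U : Module.End ℂ (complexBetti A.X 1)) *
            ((e.symm (Pi.single l 1) : ↥(bicommutant A)) : Module.End ℂ (complexBetti A.X 1))) v) =
            ((e U l 0 0) • (c : Module.End ℂ (complexBetti A.X 1))) (conjClass (ComplexPoints A.X) 1 v) := by
          intro v
          rw [h1', LinearMap.smul_apply, conjClass_smul, hreal l, LinearMap.smul_apply, hc]
        exact eq_of_conj_apply_eq hX₁ hX₂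
      -- multiply by `εₘ`: `U εₘ = λₗ εₘ`, but also `U εₘ = λₘ εₘ`
      have h3 : U * e.symm (Pi.single m 1) = (e U l 0 0) • e.symm (Pi.single m 1) := by
        have hcε' : (c : Module.End ℂ (complexBetti A.X 1)) * ((e.symm (Pi.single m 1) : ↥(bicommutant A)) :
            Module.End ℂ (complexBetti A.X 1)) = ((e.symm (Pi.single m 1) : ↥(bicommutant A)) :
            Module.End ℂ (complexBetti A.X 1)) := by
          have h := congrArg Subtype.val hcε
          rw [Subalgebra.coe_mul] at h
          exact h
        apply Subtype.ext
        rw [Subalgebra.coe_mul, Subalgebra.coe_smul, ← hcε', ← mul_assoc, h2, smul_mul_assoc]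
      have h4 : U * e.symm (Pi.single m 1) = (e U m 0 0) • e.symm (Pi.single m 1) := mul_blockId_of_mem_center e hUc m
      have h5 : ((e U l 0 0) - (e U m 0 0)) • e.symm (Pi.single m (1 : Matrix (Fin (d m)) (Fin (d m)) ℂ)) = 0 := by
        rw [sub_smul, ← h3, ← h4, sub_self]
      rcases smul_eq_zero.1 h5 with h | h
      · exact sub_eq_zero.1 h
      · exact absurd h (blockId_ne_zero e m)
    -- hence every central element of `E″` has equal `l`- and `m`-scalars: apply to `εₗ`
    have hspan := mem_span_central_pullbackOne_of_mem_center (blockId_mem_center e l)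
    have hP : ∀ Z ∈ Submodule.span ℂ {Y : Module.End ℂ (complexBetti A.X 1) |
        ∃ u : A ⟶ A, Y = pullbackOne A u ∧ pullbackOne A u ∈ centralizerAlgebra A},
        ∃ hZ : Z ∈ bicommutant A, e ⟨Z, hZ⟩ l 0 0 = e ⟨Z, hZ⟩ m 0 0 := by
      intro Z hZ
      induction hZ using Submodule.span_induction with
      | mem Z h =>
        obtain ⟨u, rfl, huC⟩ := h
        exact ⟨pullbackOne_mem_bicommutant u, hpull u huC⟩
      | zero =>
        refine ⟨Subalgebra.zero_mem _, ?_⟩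
        rw [show (⟨0, Subalgebra.zero_mem _⟩ : ↥(bicommutant A)) = 0 from rfl, map_zero]
        rfl
      | add Z Z' _ _ hZ hZ' =>
        obtain ⟨h1, e1⟩ := hZ
        obtain ⟨h2, e2⟩ := hZ'
        refine ⟨Subalgebra.add_mem _ h1 h2, ?_⟩
        have : (⟨Z + Z', Subalgebra.add_mem _ h1 h2⟩ : ↥(bicommutant A)) = ⟨Z, h1⟩ + ⟨Z', h2⟩ := rfl
        rw [this, map_add, Pi.add_apply, Pi.add_apply, Matrix.add_apply, Matrix.add_apply, e1, e2]
      | smul a Z _ hZ =>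
        obtain ⟨h1, e1⟩ := hZ
        refine ⟨Subalgebra.smul_mem _ h1 a, ?_⟩
        have : (⟨a • Z, Subalgebra.smul_mem _ h1 a⟩ : ↥(bicommutant A)) = a • ⟨Z, h1⟩ := rfl
        rw [this, map_smul, Pi.smul_apply, Pi.smul_apply, Matrix.smul_apply, Matrix.smul_apply, e1]
    obtain ⟨hε, heq⟩ := hP _ hspan
    have hεeq : (⟨(e.symm (Pi.single l 1) : Module.End ℂ (complexBetti A.X 1)), hε⟩ : ↥(bicommutant A)) =
        e.symm (Pi.single l 1) := rfl
    rw [hεeq, AlgEquiv.apply_symm_apply, Pi.single_eq_same] at heq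
    by_contra hml
    rw [Pi.single_eq_of_ne hml, Matrix.one_apply_eq, Matrix.zero_apply] at heq
    exact one_ne_zero heq
  -- conclusion: `c = Σ νₘ εₘ = εₗ`
  have hc0 : c ≠ 0 := by
    intro h0
    obtain ⟨v, hv⟩ : ∃ v, (e.symm (Pi.single l 1) : Module.End ℂ (complexBetti A.X 1)) v ≠ 0 := by
      by_contra hall
      push Not at hall
      exact blockId_ne_zero e l (Subtype.ext (LinearMap.ext hall))
    have h := hc v
    rw [h0] at h
    simp only [ZeroMemClass.coe_zero, LinearMap.zero_apply] at h
    have h' := congrArg (conjClass (ComplexPoints A.X) 1) h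
    rw [conjClass_conjClass, conjClass_zero] at h'
    exact hv h'
  have hνl : e c l 0 0 ≠ 0 := by
    intro h0
    apply hc0
    rw [eq_sum_smul_blockId_of_mem_center e hcc]
    refine Finset.sum_eq_zero fun m _ => ?_
    by_cases hm : e c m 0 0 = 0
    · rw [hm, zero_smul]
    · exact absurd h0 (key m hm ▸ hm)
  rw [eq_sum_smul_blockId_of_mem_center e hcc, Finset.sum_eq_single l (fun m _ hml => ?_)
    (fun h => absurd (Finset.mem_univ l) h)]
  · have hνl1 : e c l 0 0 = 1 := by
      have h := blockScalar_mul_self_of_mem_center_of_isIdempotent e hcc hci l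
      rcases mul_eq_zero.1 (show e c l 0 0 * (e c l 0 0 - 1) = 0 by rw [mul_sub, mul_one, h, sub_self]) with h0 | h1
      · exact absurd h0 hνl
      · exact sub_eq_zero.1 h1
    rw [hνl1, one_smul]
  · by_cases hm : e c m 0 0 = 0
    · rw [hm, zero_smul]
    · exact absurd (key m hm) hml

/-! #### The trace form vanishes on the centre of `E″` -/

/-- **`tr(εₖ | H^{1,0}) = tr(εₖ | H^{0,1})` for every central primitive idempotent of `E″`** when `A` has no factor of
type IV (both are `dim(εₖH¹ ∩ H^{1,0}) = dim(ε̄ₖH¹ ∩ H^{0,1})` and `ε̄ₖ = εₖ`).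
[cite: MoonenZarhin1998WeilClasses, §1 second Remark after the Criterion] -/
theorem trace_compress_blockId_hodgeOneZero_eq (hA4 : HasNoTypeIVFactor A) (k : Fin n) :
    LinearMap.trace ℂ ↥(hodgeOneZero hA) ((hodgeOneZero hA).projectionOnto (hodgeZeroOne hA)
        (isCompl_hodgeOneZero_hodgeZeroOne hA) ∘ₗ (e.symm (Pi.single k 1) : Module.End ℂ (complexBetti A.X 1)) ∘ₗ
        (hodgeOneZero hA).subtype) =
      LinearMap.trace ℂ ↥(hodgeZeroOne hA) ((hodgeZeroOne hA).projectionOnto (hodgeOneZero hA)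
        (isCompl_hodgeOneZero_hodgeZeroOne hA).symm ∘ₗ (e.symm (Pi.single k 1) : Module.End ℂ (complexBetti A.X 1)) ∘ₗ
        (hodgeZeroOne hA).subtype) := by
  haveI := finite_complexBetti_abelianVariety A 1
  set ε : Module.End ℂ (complexBetti A.X 1) := (e.symm (Pi.single k 1) : Module.End ℂ (complexBetti A.X 1)) with hε
  have hεE : ε ∈ bicommutant A := (e.symm (Pi.single k 1)).2
  have hεε : IsIdempotentElem ε := by
    have h := congrArg Subtype.val (blockId_mul_self e k)
    rw [Subalgebra.coe_mul] at h
    exact h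
  obtain ⟨c, hcE, hc⟩ := exists_conj_of_mem_bicommutant hεE
  have hcε : (⟨c, hcE⟩ : ↥(bicommutant A)) = e.symm (Pi.single k 1) := conj_blockId_eq_self e hA4 k hc
  have hc' : ∀ v, conjClass (ComplexPoints A.X) 1 (ε v) = ε (conjClass (ComplexPoints A.X) 1 v) := by
    intro v
    rw [hc v]
    exact congrArg (fun w : ↥(bicommutant A) => (w : Module.End ℂ (complexBetti A.X 1)) _) hcε
  rw [trace_compress_eq_finrank_of_isIdempotentElem _ hεε (fun w hw => map_mem_hodgeOneZero_of_mem_bicommutant hA hεE hw),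
    trace_compress_eq_finrank_of_isIdempotentElem _ hεε (fun w hw => map_mem_hodgeZeroOne_of_mem_bicommutant hA hεE hw),
    finrank_range_inf_hodgeOneZero_eq_of_conj_apply hA hc']

/-- **The trace form `τ = tr(· | H^{1,0}) − tr(· | H^{0,1})` vanishes on the centre of `E″`** when `A` has no factor of
type IV (the centre is spanned by the `εₖ`). [cite: MoonenZarhin1998WeilClasses, §1 second Remark after the Criterion] -/
theorem trace_compress_hodgeOneZero_eq_of_mem_center (hA4 : HasNoTypeIVFactor A) {z : ↥(bicommutant A)}
    (hz : z ∈ Subalgebra.center ℂ ↥(bicommutant A)) :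
    LinearMap.trace ℂ ↥(hodgeOneZero hA) ((hodgeOneZero hA).projectionOnto (hodgeZeroOne hA)
        (isCompl_hodgeOneZero_hodgeZeroOne hA) ∘ₗ (z : Module.End ℂ (complexBetti A.X 1)) ∘ₗ (hodgeOneZero hA).subtype) =
      LinearMap.trace ℂ ↥(hodgeZeroOne hA) ((hodgeZeroOne hA).projectionOnto (hodgeOneZero hA)
        (isCompl_hodgeOneZero_hodgeZeroOne hA).symm ∘ₗ (z : Module.End ℂ (complexBetti A.X 1)) ∘ₗ
        (hodgeZeroOne hA).subtype) := by
  haveI := finite_complexBetti_abelianVariety A 1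
  haveI : IsSemisimpleRing ↥(bicommutant A) := isSemisimpleRing_bicommutant A
  haveI : FiniteDimensional ℂ ↥(bicommutant A) :=
    FiniteDimensional.of_injective (bicommutant A).val.toLinearMap Subtype.val_injective
  obtain ⟨n, d, hd, ⟨e⟩⟩ := IsSemisimpleRing.exists_algEquiv_pi_matrix_of_isAlgClosed ℂ ↥(bicommutant A)
  haveI : ∀ i, NeZero (d i) := hd
  have hz' : (z : Module.End ℂ (complexBetti A.X 1)) =
      ∑ k, (e z k 0 0) • ((e.symm (Pi.single k 1) : ↥(bicommutant A)) : Module.End ℂ (complexBetti A.X 1)) := by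
    conv_lhs => rw [eq_sum_smul_blockId_of_mem_center e hz]
    rw [AddSubmonoidClass.coe_finsetSum]
    exact Finset.sum_congr rfl fun k _ => by rw [Subalgebra.coe_smul]
  rw [hz', compress_finset_sum, compress_finset_sum, map_sum, map_sum]
  refine Finset.sum_congr rfl fun k _ => ?_
  rw [compress_smul, compress_smul, map_smul, map_smul, trace_compress_blockId_hodgeOneZero_eq hA e hA4 k]

end Carrier

/-! ### §E₀ Spectral projectors of `φ^*`, and the engine: `τ` balanced on `Z(E″)` ⟹ `n_ρ = n_ρ̄` for every `φ` -/

section Spectral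

variable {A : AbelianVariety ℂ}

/-- `H¹ = V_ρ ⊕ (⊕_{μ ≠ ρ} V_μ)` for the semisimple `φ^*` (`P(φ) = 0` with `P` irreducible over `ℚ`). [folklore] -/
private theorem isCompl_eigenspace_iSup_ne {φ : A ⟶ A} {P : Polynomial ℤ}
    (hPirr : Irreducible (P.map (Int.castRingHom ℚ)))
    (hφ : Polynomial.eval₂ (Int.castRingHom (CategoryTheory.End A)) (φ : CategoryTheory.End A) P = 0) (ρ : ℂ) :
    IsCompl ((pullbackOne A φ).eigenspace ρ) (⨆ (μ : ℂ) (_ : μ ≠ ρ), (pullbackOne A φ).eigenspace μ) := by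
  haveI := finite_complexBetti_abelianVariety A 1
  have hsepC : (P.map (Int.castRingHom ℂ)).Separable := by
    rw [map_castRingHom_complex_eq]; exact hPirr.separable.map
  have hF0 : aeval (pullbackOne A φ) (P.map (Int.castRingHom ℂ)) = 0 := aeval_hom_complexBetti_map_one_eq_zero hφ
  have hss : (pullbackOne A φ).IsSemisimple :=
    Module.End.isSemisimple_of_squarefree_aeval_eq_zero hsepC.squarefree hF0
  refine ⟨(Module.End.eigenspaces_iSupIndep (pullbackOne A φ)) ρ, ?_⟩
  rw [codisjoint_iff, ← iSup_split_single (fun μ => (pullbackOne A φ).eigenspace μ) ρ, hss.iSup_eigenspace_eq_top]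

variable {φ : A ⟶ A} {ρ : ℂ}
  (hc : IsCompl ((pullbackOne A φ).eigenspace ρ) (⨆ (μ : ℂ) (_ : μ ≠ ρ), (pullbackOne A φ).eigenspace μ))

/-- **The spectral projector `π_ρ` onto `V_ρ` along `⊕_{μ ≠ ρ} V_μ` lies in `E″`**: it commutes with Milne's `C(A) ⊗ ℂ`,
every element of which preserves each `V_μ`. [folklore] -/
private theorem projection_mem_bicommutant : ((pullbackOne A φ).eigenspace ρ).projection _ hc ∈ bicommutant A := by
  set F : Module.End ℂ (complexBetti A.X 1) := pullbackOne A φ with hFdef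
  set W : Submodule ℂ (complexBetti A.X 1) := ⨆ (μ : ℂ) (_ : μ ≠ ρ), F.eigenspace μ with hWdef
  set π : Module.End ℂ (complexBetti A.X 1) := (F.eigenspace ρ).projection W hc with hπdef
  refine (Subalgebra.mem_centralizer_iff ℂ).2 fun T hT => ?_
  have hTF : ∀ x, T (F x) = F (T x) := (mem_centralizerAlgebra_iff'.1 hT) φ
  have hTV : ∀ (μ : ℂ), ∀ x ∈ F.eigenspace μ, T x ∈ F.eigenspace μ := by
    intro μ x hx
    rw [Module.End.mem_eigenspace_iff] at hx ⊢
    rw [← hTF, hx, map_smul]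
  have hTW : ∀ x ∈ W, T x ∈ W := by
    have hle : W ≤ W.comap T := by
      rw [hWdef]
      refine iSup₂_le fun μ hμ x hx => ?_
      rw [Submodule.mem_comap]
      exact (le_iSup₂_of_le (f := fun (μ : ℂ) (_ : μ ≠ ρ) => F.eigenspace μ) μ hμ le_rfl) (hTV μ x hx)
    exact fun x hx => hle hx
  refine LinearMap.ext fun v => ?_
  rw [Module.End.mul_apply, Module.End.mul_apply]
  have h1 : π (T (π v)) = T (π v) :=
    Submodule.projection_apply_of_mem_left hc (hTV ρ _ (Submodule.projection_apply_mem hc v))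
  have h2 : π (T (v - π v)) = 0 :=
    Submodule.projection_apply_of_mem_right hc (hTW _ (Submodule.sub_projection_mem hc v))
  calc T (π v) = π (T (π v)) := h1.symm
    _ = π (T (π v)) + π (T (v - π v)) := by rw [h2, add_zero]
    _ = π (T v) := by rw [← map_add, ← map_add, add_sub_cancel]

/-- `π_ρ v = v` on `V_ρ` and `π_ρ v = 0` on `V_μ`, `μ ≠ ρ`. [folklore] -/
private theorem projection_apply_of_mem_eigenspace {μ : ℂ} {v : complexBetti A.X 1}
    (hv : v ∈ (pullbackOne A φ).eigenspace μ) :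
    ((pullbackOne A φ).eigenspace ρ).projection _ hc v = if μ = ρ then v else 0 := by
  split_ifs with hμ
  · subst hμ
    exact Submodule.projection_apply_of_mem_left hc hv
  · exact Submodule.projection_apply_of_mem_right hc
      ((le_iSup₂_of_le (f := fun (μ : ℂ) (_ : μ ≠ ρ) => (pullbackOne A φ).eigenspace μ) μ hμ le_rfl) hv)

/-- `tr(π_ρ | H^{1,0}) = n_ρ = dim(V_ρ ∩ H^{1,0})`. [folklore] -/
private theorem trace_compress_projection_hodgeOneZero_eq (hA : IsSmoothProjective A.dim A.X) :
    LinearMap.trace ℂ ↥(hodgeOneZero hA) ((hodgeOneZero hA).projectionOnto (hodgeZeroOne hA)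
        (isCompl_hodgeOneZero_hodgeZeroOne hA) ∘ₗ ((pullbackOne A φ).eigenspace ρ).projection _ hc ∘ₗ
        (hodgeOneZero hA).subtype) = (eigenMultiplicity A φ ρ : ℂ) := by
  haveI := finite_complexBetti_abelianVariety A 1
  have hπE := projection_mem_bicommutant hc
  rw [trace_compress_eq_finrank_of_isIdempotentElem _ (Submodule.isIdempotentElem_projection hc)
      (fun w hw => map_mem_hodgeOneZero_of_mem_bicommutant hA hπE hw), Submodule.range_projection hc]
  rfl

/-- `tr(π_ρ | H^{0,1}) = n_ρ̄` (`dim(V_ρ ∩ H^{0,1}) = dim(V_ρ̄ ∩ H^{1,0})`, complex conjugation). [folklore] -/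
private theorem trace_compress_projection_hodgeZeroOne_eq (hA : IsSmoothProjective A.dim A.X) :
    LinearMap.trace ℂ ↥(hodgeZeroOne hA) ((hodgeZeroOne hA).projectionOnto (hodgeOneZero hA)
        (isCompl_hodgeOneZero_hodgeZeroOne hA).symm ∘ₗ ((pullbackOne A φ).eigenspace ρ).projection _ hc ∘ₗ
        (hodgeZeroOne hA).subtype) = (eigenMultiplicity A φ (starRingEnd ℂ ρ) : ℂ) := by
  haveI := finite_complexBetti_abelianVariety A 1
  have hπE := projection_mem_bicommutant hc
  rw [trace_compress_eq_finrank_of_isIdempotentElem _ (Submodule.isIdempotentElem_projection hc)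
      (fun w hw => map_mem_hodgeZeroOne_of_mem_bicommutant hA hπE hw), Submodule.range_projection hc]
  congr 1
  rw [eigenMultiplicity, ← finrank_eigenspace_inf_hodgeZeroOne_eq hA φ.hom.hom.hom (starRingEnd ℂ ρ), Complex.conj_conj]

/-- **Spectral expansion: `q(φ^*) = Σ_{P(ρ) = 0} q(ρ) π_ρ`** for the semisimple `φ^*` and any `q ∈ ℂ[T]`. [folklore] -/
private theorem aeval_pullbackOne_eq_sum_smul_projection {P : Polynomial ℤ} (hP0 : P ≠ 0)
    (hPirr : Irreducible (P.map (Int.castRingHom ℚ)))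
    (hφ : Polynomial.eval₂ (Int.castRingHom (CategoryTheory.End A)) (φ : CategoryTheory.End A) P = 0) (q : ℂ[X]) :
    aeval (pullbackOne A φ) q = ∑ ρ ∈ (P.map (Int.castRingHom ℂ)).roots.toFinset,
      q.eval ρ • ((pullbackOne A φ).eigenspace ρ).projection _ (isCompl_eigenspace_iSup_ne hPirr hφ ρ) := by
  haveI := finite_complexBetti_abelianVariety A 1
  have hsepC : (P.map (Int.castRingHom ℂ)).Separable := by
    rw [map_castRingHom_complex_eq]; exact hPirr.separable.map
  have hF0 : aeval (pullbackOne A φ) (P.map (Int.castRingHom ℂ)) = 0 := aeval_hom_complexBetti_map_one_eq_zero hφ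
  have hss : (pullbackOne A φ).IsSemisimple :=
    Module.End.isSemisimple_of_squarefree_aeval_eq_zero hsepC.squarefree hF0
  have htop : ⨆ μ, (pullbackOne A φ).eigenspace μ = ⊤ := hss.iSup_eigenspace_eq_top
  -- eigenvalues are roots of `P`
  have hroot : ∀ (μ : ℂ) (v : complexBetti A.X 1), v ∈ (pullbackOne A φ).eigenspace μ → v ≠ 0 →
      μ ∈ (P.map (Int.castRingHom ℂ)).roots.toFinset := by
    intro μ v hv hv0
    have h := Module.End.aeval_apply_of_hasEigenvector (f := pullbackOne A φ) (p := P.map (Int.castRingHom ℂ))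
      (Module.End.hasEigenvector_iff.2 ⟨hv, hv0⟩)
    rw [hF0, LinearMap.zero_apply, Polynomial.eval_map] at h
    exact (mem_roots_toFinset_map_iff hP0 μ).2 ((smul_eq_zero.1 h.symm).resolve_right hv0)
  refine LinearMap.ext fun v => ?_
  have hv : v ∈ ⨆ μ, (pullbackOne A φ).eigenspace μ := by rw [htop]; exact Submodule.mem_top
  induction hv using Submodule.iSup_induction' with
  | mem μ w hw =>
    by_cases hw0 : w = 0
    · rw [hw0, map_zero, map_zero]
    · rw [Module.End.aeval_apply_of_hasEigenvector (Module.End.hasEigenvector_iff.2 ⟨hw, hw0⟩), LinearMap.sum_apply,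
        Finset.sum_eq_single_of_mem μ (hroot μ w hw hw0) fun ρ' _ hρ' => ?_]
      · rw [LinearMap.smul_apply, projection_apply_of_mem_eigenspace _ hw, if_pos rfl]
      · rw [LinearMap.smul_apply, projection_apply_of_mem_eigenspace _ hw, if_neg (Ne.symm hρ'), smul_zero]
  | zero => rw [map_zero, map_zero]
  | add w w' _ _ hw hw' => rw [map_add, map_add, hw, hw']

/-- **THE ENGINE OF THIS FILE: if `tr(z | H^{1,0}) = tr(z | H^{0,1})` for every CENTRAL `z ∈ E″`, then `n_ρ = n_ρ̄` for
EVERY `φ ∈ End(A)` killed by an irreducible `P ∈ ℤ[T]` and every `ρ ∈ ℂ`.**  The trace form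
`τ = tr(· | H^{1,0}) − tr(· | H^{0,1})` on the semisimple `E″` kills commutators (§B) and, by hypothesis, the centre, so it
vanishes (§A); and `τ(π_ρ) = n_ρ − n_ρ̄` for the spectral projector `π_ρ ∈ E″` onto `V_ρ = ker(φ^* − ρ)`.  Both printed
statements served here are instances: the second Remark after the Criterion (no factor of type IV, §E) and Remark (1)
after Criterion (2) («if `E ⊂ F′` … then for any other subfield `F ⊆ End⁰(X)`, the space `W_F` also consists of Hodge
classes», §F) (module docstring, PROOF ROUTE — a deviation from the printed Hodge-group argument, recorded there).
[cite: MoonenZarhin1998WeilClasses, §1 second Remark after the Criterion (chunk p0002) and Remark (1) after Criterion (2) (chunk p0004)]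
[cite: Deligne1982HodgeCycles, I §3 Prop. 3.4] -/
theorem eigenMultiplicity_eq_of_forall_center_trace_eq (hA : IsSmoothProjective A.dim A.X)
    (hZ : ∀ z : ↥(bicommutant A), z ∈ Subalgebra.center ℂ ↥(bicommutant A) →
      LinearMap.trace ℂ ↥(hodgeOneZero hA) ((hodgeOneZero hA).projectionOnto (hodgeZeroOne hA)
          (isCompl_hodgeOneZero_hodgeZeroOne hA) ∘ₗ (z : Module.End ℂ (complexBetti A.X 1)) ∘ₗ
          (hodgeOneZero hA).subtype) =
        LinearMap.trace ℂ ↥(hodgeZeroOne hA) ((hodgeZeroOne hA).projectionOnto (hodgeOneZero hA)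
          (isCompl_hodgeOneZero_hodgeZeroOne hA).symm ∘ₗ (z : Module.End ℂ (complexBetti A.X 1)) ∘ₗ
          (hodgeZeroOne hA).subtype))
    {P : Polynomial ℤ} (hPirr : Irreducible (P.map (Int.castRingHom ℚ)))
    (hφ : Polynomial.eval₂ (Int.castRingHom (CategoryTheory.End A)) (φ : CategoryTheory.End A) P = 0) (ρ : ℂ) :
    eigenMultiplicity A φ ρ = eigenMultiplicity A φ (starRingEnd ℂ ρ) := by
  classical
  haveI := finite_complexBetti_abelianVariety A 1
  have hcρ := isCompl_eigenspace_iSup_ne hPirr hφ ρ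
  have hπE : ((pullbackOne A φ).eigenspace ρ).projection _ hcρ ∈ bicommutant A := projection_mem_bicommutant hcρ
  -- the trace form `τ` on `E″`
  haveI : IsSemisimpleRing ↥(bicommutant A) := isSemisimpleRing_bicommutant A
  haveI : FiniteDimensional ℂ ↥(bicommutant A) :=
    FiniteDimensional.of_injective (bicommutant A).val.toLinearMap Subtype.val_injective
  set H10 := hodgeOneZero hA with hH10
  set H01 := hodgeZeroOne hA with hH01
  have hcH : IsCompl H10 H01 := isCompl_hodgeOneZero_hodgeZeroOne hA
  set cp10 : Module.End ℂ (complexBetti A.X 1) →ₗ[ℂ] Module.End ℂ ↥H10 :=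
    (LinearMap.llcomp ℂ ↥H10 (complexBetti A.X 1) ↥H10 (H10.projectionOnto H01 hcH)) ∘ₗ
      (LinearMap.lcomp ℂ (complexBetti A.X 1) H10.subtype) with hcp10
  set cp01 : Module.End ℂ (complexBetti A.X 1) →ₗ[ℂ] Module.End ℂ ↥H01 :=
    (LinearMap.llcomp ℂ ↥H01 (complexBetti A.X 1) ↥H01 (H01.projectionOnto H10 hcH.symm)) ∘ₗ
      (LinearMap.lcomp ℂ (complexBetti A.X 1) H01.subtype) with hcp01
  set τ : ↥(bicommutant A) →ₗ[ℂ] ℂ :=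
    ((LinearMap.trace ℂ ↥H10) ∘ₗ cp10 - (LinearMap.trace ℂ ↥H01) ∘ₗ cp01) ∘ₗ (bicommutant A).val.toLinearMap with hτ
  have hτ_apply : ∀ X : ↥(bicommutant A), τ X =
      LinearMap.trace ℂ ↥H10 (H10.projectionOnto H01 hcH ∘ₗ (X : Module.End ℂ (complexBetti A.X 1)) ∘ₗ H10.subtype) -
        LinearMap.trace ℂ ↥H01 (H01.projectionOnto H10 hcH.symm ∘ₗ (X : Module.End ℂ (complexBetti A.X 1)) ∘ₗ
          H01.subtype) := fun X => rfl
  -- `τ ≡ 0` on `E″`: it kills commutators (cyclicity on `H^{1,0}` and on `H^{0,1}`) and the centre (hypothesis)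
  have hτ0 : τ = 0 := by
    refine traceForm_eq_zero_of_center τ (fun X Y => ?_) (fun z hz => ?_)
    · rw [hτ_apply, hτ_apply, Subalgebra.coe_mul, Subalgebra.coe_mul,
        trace_compress_mul_comm hcH (fun w hw => map_mem_hodgeOneZero_of_mem_bicommutant hA X.2 hw)
          (fun w hw => map_mem_hodgeOneZero_of_mem_bicommutant hA Y.2 hw),
        trace_compress_mul_comm hcH.symm (fun w hw => map_mem_hodgeZeroOne_of_mem_bicommutant hA X.2 hw)
          (fun w hw => map_mem_hodgeZeroOne_of_mem_bicommutant hA Y.2 hw)]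
    · rw [hτ_apply, hZ z hz, sub_self]
  -- `0 = τ(π_ρ) = n_ρ − n_ρ̄`
  have hτπ := LinearMap.congr_fun hτ0 ⟨_, hπE⟩
  rw [hτ_apply, LinearMap.zero_apply, sub_eq_zero, trace_compress_projection_hodgeOneZero_eq hcρ hA,
    trace_compress_projection_hodgeZeroOne_eq hcρ hA, Nat.cast_inj] at hτπ
  exact hτπ

end Spectral

/-! ### §E No factor of type IV ⟹ `n_ρ = n_ρ̄`, and `W_F` consists of Hodge classes -/

section Main

variable {A : AbelianVariety ℂ} {φ : A ⟶ A} {P : Polynomial ℤ} {e r m : ℕ}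

/-- **MOONEN–ZARHIN 1998, §1, SECOND REMARK AFTER THE CRITERION, AS PRINTED: «If all simple factors of `X` are of type
1, 2 or 3 in the Albert classification, then every subfield `F ⊆ End⁰(X)` satisfies the condition that `n_σ = n_σ′` for
all `σ ∈ Σ_F`».**  For a complex abelian variety `A` with `HasNoTypeIVFactor A`, an endomorphism `φ` with `P(φ) = 0` for
`P ∈ ℤ[T]` irreducible over `ℚ` (so that `φ^*` is semisimple on `H¹(A(ℂ); ℂ)`), and any `ρ ∈ ℂ`:
`eigenMultiplicity A φ ρ = eigenMultiplicity A φ ρ̄`, i.e. `dim (V_ρ ∩ H^{1,0}) = dim (V_ρ̄ ∩ H^{1,0})`.  Proof by the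
trace form `τ = tr(· | H^{1,0}) − tr(· | H^{0,1})` on `E″` (§A–§D): `τ ≡ 0`, and `τ(π_ρ) = n_ρ − n_ρ̄` for the spectral
projector `π_ρ ∈ E″` onto `V_ρ` (module docstring, PROOF ROUTE).
[cite: MoonenZarhin1998WeilClasses, §1 second Remark after the Criterion (chunk p0002)]
[cite: Deligne1982HodgeCycles, I §3 Prop. 3.4] [cite: LangeBirkenhake1992, §5.5] -/
theorem eigenMultiplicity_eq_of_hasNoTypeIVFactor (hA4 : HasNoTypeIVFactor A)
    (hPirr : Irreducible (P.map (Int.castRingHom ℚ)))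
    (hφ : Polynomial.eval₂ (Int.castRingHom (CategoryTheory.End A)) (φ : CategoryTheory.End A) P = 0) (ρ : ℂ) :
    eigenMultiplicity A φ ρ = eigenMultiplicity A φ (starRingEnd ℂ ρ) :=
  have hA : IsSmoothProjective A.dim A.X := AbelianVariety.isSmoothProjective_holds (A := A)
  -- the trace form is balanced on the centre of `E″` (§D), so the engine (§E₀) applies
  eigenMultiplicity_eq_of_forall_center_trace_eq hA (fun _ hz => trace_compress_hodgeOneZero_eq_of_mem_center hA hA4 hz)
    hPirr hφ ρ

/-- **… hence, with the Criterion: no factor of type IV ⟹ `W_F` consists of Hodge classes** («which means that `W_F`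
consists of Hodge classes»): `W_F ⊗ ℂ ≤ Bᵐ ⊗ ℂ` for `P` monic irreducible of degree `e`, `P(φ) = 0`, `e · 2m = 2 dim A`
(the tree's `Deligne1982.weilClassesField_le_hodgeClassSpan_iff_forall_eigenMultiplicity_eq`).
[cite: MoonenZarhin1998WeilClasses, §1 Criterion and second Remark after it (chunk p0002)] -/
theorem weilClassesField_le_hodgeClassSpan_of_hasNoTypeIVFactor (hA4 : HasNoTypeIVFactor A) (hPm : P.Monic)
    (hPe : P.natDegree = e) (hPirr : Irreducible (P.map (Int.castRingHom ℚ)))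
    (hφ : Polynomial.eval₂ (Int.castRingHom (CategoryTheory.End A)) (φ : CategoryTheory.End A) P = 0)
    (her : e * (2 * m) = 2 * A.dim) :
    weilClassesField A φ P (2 * m) ≤ hodgeClassSpan A.dim A.X m :=
  (Deligne1982.weilClassesField_le_hodgeClassSpan_iff_forall_eigenMultiplicity_eq hPm hPe hPirr hφ her).2
    fun ρ _ => eigenMultiplicity_eq_of_hasNoTypeIVFactor hA4 hPirr hφ ρ

/-- **… class by class: every class of `W_F ⊗ ℂ` is of Hodge type `(r/2, r/2)`** (`e · r = 2 dim A`; the tree's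
`MoonenZarhin1998_weilClasses_hodgeCriterion_holds`, part (i)).
[cite: MoonenZarhin1998WeilClasses, §1 Criterion and second Remark after it (chunk p0002)] -/
theorem forall_isOfHodgeType_of_mem_weilClassesField_of_hasNoTypeIVFactor (hA4 : HasNoTypeIVFactor A) (hPm : P.Monic)
    (hPe : P.natDegree = e) (hPirr : Irreducible (P.map (Int.castRingHom ℚ)))
    (hφ : Polynomial.eval₂ (Int.castRingHom (CategoryTheory.End A)) (φ : CategoryTheory.End A) P = 0)
    (her : e * r = 2 * A.dim) :
    ∀ c ∈ weilClassesField A φ P r, IsOfHodgeType A.dim A.X r (r / 2) (r / 2) c :=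
  (MoonenZarhin1998_weilClasses_hodgeCriterion_holds A φ P e r hPm hPe hPirr hφ her).1
    fun ρ _ => eigenMultiplicity_eq_of_hasNoTypeIVFactor hA4 hPirr hφ ρ

/-- **«hence contained in `Sl_F(V_X)`», read on `Hg|_{H¹}`**: with no factor of type IV, the degree-one Hodge group lies in
`SU(φ)(ℂ)` for every `h ∈ B¹(A) ⊗ ℂ` (`e · 2m = 2 dim A`; the tree's
`Deligne1982.hodgeGroupOne_le_weilSpecialUnitaryGroupCM_of_forall_eigenMultiplicity_eq`).
[cite: MoonenZarhin1998WeilClasses, §1 second Remark after the Criterion («Hdg(X) … contained in Sl_F(V_X)»)] -/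
theorem hodgeGroupOne_le_weilSpecialUnitaryGroupCM_of_hasNoTypeIVFactor (hA4 : HasNoTypeIVFactor A) (hPm : P.Monic)
    (hPe : P.natDegree = e) (hPirr : Irreducible (P.map (Int.castRingHom ℚ)))
    (hφ : Polynomial.eval₂ (Int.castRingHom (CategoryTheory.End A)) (φ : CategoryTheory.End A) P = 0)
    (her : e * (2 * m) = 2 * A.dim) {h : complexBetti A.X 2} (hh : h ∈ hodgeClassSpan A.dim A.X 1) :
    hodgeGroupOne A.dim A.X ≤ Deligne1982.weilSpecialUnitaryGroupCM A φ P h :=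
  Deligne1982.hodgeGroupOne_le_weilSpecialUnitaryGroupCM_of_forall_eigenMultiplicity_eq hPm hPe hPirr hφ her
    (fun ρ _ => eigenMultiplicity_eq_of_hasNoTypeIVFactor hA4 hPirr hφ ρ) hh

end Main

/-! ### §F «`E ⊂ F′` and `W_{F′}` Hodge ⟹ for any other subfield `F`, `W_F` also consists of Hodge classes»
(Remark (1) after Criterion (2)), by the same trace form -/

section CenterInSubfield

variable {A : AbelianVariety ℂ} {φ' : A ⟶ A} {P' : Polynomial ℤ} {e' m' : ℕ} {φ : A ⟶ A} {P : Polynomial ℤ} {e r m : ℕ}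

/-- **«`Z(Hdg) ⊂ U_E`», AT THE LEVEL OF `E″`, UNDER «`E ⊂ F′`» WITH `W_{F′}` HODGE: the trace form is balanced on the centre
of `E″`.**  If every CENTRAL pull-back `u^*` (`u^* ∈ C(A) ⊗ ℂ`) is a polynomial in `φ′^*` («`E ⊗ ℂ ⊆ F′ ⊗ ℂ`», `F′ = ℚ(φ′)`,
`P′(φ′) = 0` with `P′` irreducible over `ℚ`) and the multiplicities of `φ′` are balanced (`n_{ρ′} = n_{ρ̄′}` at every
complex root of `P′` — Criterion (1): `W_{F′}` Hodge), then `tr(z | H^{1,0}) = tr(z | H^{0,1})` for every `z ∈ Z(E″)`: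
`z` lies in the span of the central pull-backs (§D), so `z = q(φ′^*) = Σ_{ρ′} q(ρ′) π′_{ρ′}` (spectral expansion, §E₀), and
`tr(π′_{ρ′} | H^{1,0}) − tr(π′_{ρ′} | H^{0,1}) = n_{ρ′} − n_{ρ̄′} = 0`.
[cite: MoonenZarhin1998WeilClasses, §1 Remark (1) after Criterion (2) (chunk p0004: «the center Z(Hdg) of the Hodge group is contained in the torus U_E»)]
[cite: Deligne1982HodgeCycles, I §3 Prop. 3.4] -/
theorem trace_compress_hodgeOneZero_eq_of_mem_center_of_adjoin (hA : IsSmoothProjective A.dim A.X)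
    (hP'irr : Irreducible (P'.map (Int.castRingHom ℚ)))
    (hφ' : Polynomial.eval₂ (Int.castRingHom (CategoryTheory.End A)) (φ' : CategoryTheory.End A) P' = 0)
    (hE : ∀ u : A ⟶ A, pullbackOne A u ∈ centralizerAlgebra A → pullbackOne A u ∈ Algebra.adjoin ℂ {pullbackOne A φ'})
    (hbal' : ∀ ρ' : ℂ, Polynomial.eval₂ (Int.castRingHom ℂ) ρ' P' = 0 →
      eigenMultiplicity A φ' ρ' = eigenMultiplicity A φ' (starRingEnd ℂ ρ'))
    {z : ↥(bicommutant A)} (hz : z ∈ Subalgebra.center ℂ ↥(bicommutant A)) :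
    LinearMap.trace ℂ ↥(hodgeOneZero hA) ((hodgeOneZero hA).projectionOnto (hodgeZeroOne hA)
        (isCompl_hodgeOneZero_hodgeZeroOne hA) ∘ₗ (z : Module.End ℂ (complexBetti A.X 1)) ∘ₗ (hodgeOneZero hA).subtype) =
      LinearMap.trace ℂ ↥(hodgeZeroOne hA) ((hodgeZeroOne hA).projectionOnto (hodgeOneZero hA)
        (isCompl_hodgeOneZero_hodgeZeroOne hA).symm ∘ₗ (z : Module.End ℂ (complexBetti A.X 1)) ∘ₗ
        (hodgeZeroOne hA).subtype) := by
  classical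
  haveI := finite_complexBetti_abelianVariety A 1
  have hP'0 : P' ≠ 0 := by
    rintro rfl
    rw [Polynomial.map_zero] at hP'irr
    exact not_irreducible_zero hP'irr
  -- `z = q(φ′^*)`
  have hmem : (z : Module.End ℂ (complexBetti A.X 1)) ∈
      Subalgebra.toSubmodule (Algebra.adjoin ℂ {pullbackOne A φ'}) := by
    refine (Submodule.span_le.2 ?_) (mem_span_central_pullbackOne_of_mem_center hz)
    rintro Y ⟨u, rfl, huC⟩
    exact hE u huC
  rw [Subalgebra.mem_toSubmodule, Algebra.adjoin_singleton_eq_range_aeval] at hmem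
  obtain ⟨q, hq⟩ := hmem
  replace hq : aeval (pullbackOne A φ') q = (z : Module.End ℂ (complexBetti A.X 1)) := hq
  -- `= Σ_{ρ′} q(ρ′) π′_{ρ′}`, and `tr(π′_{ρ′} | H^{1,0}) = n_{ρ′} = n_{ρ̄′} = tr(π′_{ρ′} | H^{0,1})`
  rw [← hq, aeval_pullbackOne_eq_sum_smul_projection hP'0 hP'irr hφ' q, compress_finset_sum, compress_finset_sum,
    map_sum, map_sum]
  refine Finset.sum_congr rfl fun ρ' hρ' => ?_
  rw [compress_smul, compress_smul, map_smul, map_smul, trace_compress_projection_hodgeOneZero_eq _ hA,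
    trace_compress_projection_hodgeZeroOne_eq _ hA, hbal' ρ' ((mem_roots_toFinset_map_iff hP'0 ρ').1 hρ')]

/-- **MOONEN–ZARHIN 1998, §1, REMARK (1) AFTER CRITERION (2), THE CONCLUSION «if `E ⊂ F′`, then `W_{F′}` consists of Hodge
classes if and only if `Hdg` is semi-simple.  If this holds, then for any other subfield `F ⊆ End⁰(X)`, the space `W_F`
also consists of Hodge classes», composed into ONE implication on the carriers** (the intermediate «`Hdg` semi-simple» is
bypassed by the trace form; for it see the seat's `WeilClassesFieldHodgeSemisimpleHodgeGroup`): if every central pull-back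
is a polynomial in `φ′^*` («`E ⊂ F′ = ℚ(φ′)`») and `n_{ρ′} = n_{ρ̄′}` at every complex root of `P′` (`W_{F′}` Hodge), then
for EVERY `φ ∈ End(A)` killed by an irreducible `P ∈ ℤ[T]` and every `ρ ∈ ℂ`: `n_ρ = n_ρ̄`.
[cite: MoonenZarhin1998WeilClasses, §1 Remark (1) after Criterion (2) (chunk p0004) and Criterion (1) (chunk p0001)]
[cite: Deligne1982HodgeCycles, I §3 Prop. 3.4] -/
theorem eigenMultiplicity_eq_of_center_le_adjoin (hP'irr : Irreducible (P'.map (Int.castRingHom ℚ)))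
    (hφ' : Polynomial.eval₂ (Int.castRingHom (CategoryTheory.End A)) (φ' : CategoryTheory.End A) P' = 0)
    (hE : ∀ u : A ⟶ A, pullbackOne A u ∈ centralizerAlgebra A → pullbackOne A u ∈ Algebra.adjoin ℂ {pullbackOne A φ'})
    (hbal' : ∀ ρ' : ℂ, Polynomial.eval₂ (Int.castRingHom ℂ) ρ' P' = 0 →
      eigenMultiplicity A φ' ρ' = eigenMultiplicity A φ' (starRingEnd ℂ ρ'))
    (hPirr : Irreducible (P.map (Int.castRingHom ℚ)))
    (hφ : Polynomial.eval₂ (Int.castRingHom (CategoryTheory.End A)) (φ : CategoryTheory.End A) P = 0) (ρ : ℂ) :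
    eigenMultiplicity A φ ρ = eigenMultiplicity A φ (starRingEnd ℂ ρ) :=
  have hA : IsSmoothProjective A.dim A.X := AbelianVariety.isSmoothProjective_holds (A := A)
  eigenMultiplicity_eq_of_forall_center_trace_eq hA
    (fun _ hz => trace_compress_hodgeOneZero_eq_of_mem_center_of_adjoin hA hP'irr hφ' hE hbal' hz) hPirr hφ ρ

/-- **… in the `W`-language: `E ⊂ F′` and `W_{F′} ⊗ ℂ ≤ B^{m′} ⊗ ℂ` ⟹ `W_F ⊗ ℂ ≤ Bᵐ ⊗ ℂ` for every other `F = ℚ(φ)`**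
(`P′`, `P` monic irreducible of degrees `e′`, `e`; `e′ · 2m′ = 2 dim A = e · 2m`; Criterion (1) on both sides, the
tree's `Deligne1982.weilClassesField_le_hodgeClassSpan_iff_forall_eigenMultiplicity_eq`).
[cite: MoonenZarhin1998WeilClasses, §1 Remark (1) after Criterion (2) (chunk p0004) and the Criterion (chunk p0001)] -/
theorem weilClassesField_le_hodgeClassSpan_of_center_le_adjoin (hP'm : P'.Monic) (hP'e : P'.natDegree = e')
    (hP'irr : Irreducible (P'.map (Int.castRingHom ℚ)))
    (hφ' : Polynomial.eval₂ (Int.castRingHom (CategoryTheory.End A)) (φ' : CategoryTheory.End A) P' = 0)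
    (her' : e' * (2 * m') = 2 * A.dim)
    (hE : ∀ u : A ⟶ A, pullbackOne A u ∈ centralizerAlgebra A → pullbackOne A u ∈ Algebra.adjoin ℂ {pullbackOne A φ'})
    (hW' : weilClassesField A φ' P' (2 * m') ≤ hodgeClassSpan A.dim A.X m')
    (hPm : P.Monic) (hPe : P.natDegree = e) (hPirr : Irreducible (P.map (Int.castRingHom ℚ)))
    (hφ : Polynomial.eval₂ (Int.castRingHom (CategoryTheory.End A)) (φ : CategoryTheory.End A) P = 0)
    (her : e * (2 * m) = 2 * A.dim) :
    weilClassesField A φ P (2 * m) ≤ hodgeClassSpan A.dim A.X m :=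
  (Deligne1982.weilClassesField_le_hodgeClassSpan_iff_forall_eigenMultiplicity_eq hPm hPe hPirr hφ her).2
    fun ρ _ => eigenMultiplicity_eq_of_center_le_adjoin hP'irr hφ' hE
      ((Deligne1982.weilClassesField_le_hodgeClassSpan_iff_forall_eigenMultiplicity_eq hP'm hP'e hP'irr hφ' her').1 hW')
      hPirr hφ ρ

/-- **… class by class: under the same hypotheses every class of `W_F ⊗ ℂ ⊆ Hʳ` is of Hodge type `(r/2, r/2)`**
(`e · r = 2 dim A`; the tree's `MoonenZarhin1998_weilClasses_hodgeCriterion_holds`, part (i)).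
[cite: MoonenZarhin1998WeilClasses, §1 Remark (1) after Criterion (2) (chunk p0004) and the Criterion (chunk p0001)] -/
theorem forall_isOfHodgeType_of_mem_weilClassesField_of_center_le_adjoin
    (hP'irr : Irreducible (P'.map (Int.castRingHom ℚ)))
    (hφ' : Polynomial.eval₂ (Int.castRingHom (CategoryTheory.End A)) (φ' : CategoryTheory.End A) P' = 0)
    (hE : ∀ u : A ⟶ A, pullbackOne A u ∈ centralizerAlgebra A → pullbackOne A u ∈ Algebra.adjoin ℂ {pullbackOne A φ'})
    (hbal' : ∀ ρ' : ℂ, Polynomial.eval₂ (Int.castRingHom ℂ) ρ' P' = 0 →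
      eigenMultiplicity A φ' ρ' = eigenMultiplicity A φ' (starRingEnd ℂ ρ'))
    (hPm : P.Monic) (hPe : P.natDegree = e) (hPirr : Irreducible (P.map (Int.castRingHom ℚ)))
    (hφ : Polynomial.eval₂ (Int.castRingHom (CategoryTheory.End A)) (φ : CategoryTheory.End A) P = 0)
    (her : e * r = 2 * A.dim) :
    ∀ c ∈ weilClassesField A φ P r, IsOfHodgeType A.dim A.X r (r / 2) (r / 2) c :=
  (MoonenZarhin1998_weilClasses_hodgeCriterion_holds A φ P e r hPm hPe hPirr hφ her).1
    fun ρ _ => eigenMultiplicity_eq_of_center_le_adjoin hP'irr hφ' hE hbal' hPirr hφ ρ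

/-- **… and on the groups: `Hg|_{H¹} ≤ SU(φ)(ℂ)` for every such `φ` and every `h ∈ B¹(A) ⊗ ℂ`** (`e · 2m = 2 dim A`; the
tree's `Deligne1982.hodgeGroupOne_le_weilSpecialUnitaryGroupCM_of_forall_eigenMultiplicity_eq`) — «the action of `Hdg` on
`W_F` is given by the `F`-linear determinant». [cite: MoonenZarhin1998WeilClasses, §1 Remark (1) after Criterion (2)
(chunk p0004) and the second Remark after the Criterion («contained in Sl_F(V_X)»)] -/
theorem hodgeGroupOne_le_weilSpecialUnitaryGroupCM_of_center_le_adjoin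
    (hP'irr : Irreducible (P'.map (Int.castRingHom ℚ)))
    (hφ' : Polynomial.eval₂ (Int.castRingHom (CategoryTheory.End A)) (φ' : CategoryTheory.End A) P' = 0)
    (hE : ∀ u : A ⟶ A, pullbackOne A u ∈ centralizerAlgebra A → pullbackOne A u ∈ Algebra.adjoin ℂ {pullbackOne A φ'})
    (hbal' : ∀ ρ' : ℂ, Polynomial.eval₂ (Int.castRingHom ℂ) ρ' P' = 0 →
      eigenMultiplicity A φ' ρ' = eigenMultiplicity A φ' (starRingEnd ℂ ρ'))
    (hPm : P.Monic) (hPe : P.natDegree = e) (hPirr : Irreducible (P.map (Int.castRingHom ℚ)))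
    (hφ : Polynomial.eval₂ (Int.castRingHom (CategoryTheory.End A)) (φ : CategoryTheory.End A) P = 0)
    (her : e * (2 * m) = 2 * A.dim) {h : complexBetti A.X 2} (hh : h ∈ hodgeClassSpan A.dim A.X 1) :
    hodgeGroupOne A.dim A.X ≤ Deligne1982.weilSpecialUnitaryGroupCM A φ P h :=
  Deligne1982.hodgeGroupOne_le_weilSpecialUnitaryGroupCM_of_forall_eigenMultiplicity_eq hPm hPe hPirr hφ her
    (fun ρ _ => eigenMultiplicity_eq_of_center_le_adjoin hP'irr hφ' hE hbal' hPirr hφ ρ) hh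

/-- **THE CASE `F′ ⊇ E` TOTALLY REAL: if every complex root of `P′` is real, the balance `n_{ρ′} = n_{ρ̄′}` is automatic**
(`ρ̄′ = ρ′`), so «`E ⊂ F′`» alone gives `n_ρ = n_ρ̄` for every `φ` (consistent with the second Remark: a totally real
`F′ ⊇ E` forces `E` totally real, i.e. no factor of type IV).
[cite: MoonenZarhin1998WeilClasses, §1 Remark (1) after Criterion (2) (chunk p0004) and the second Remark after the Criterion (chunk p0002)] -/
theorem eigenMultiplicity_eq_of_center_le_adjoin_of_forall_root_im_eq_zero
    (hP'irr : Irreducible (P'.map (Int.castRingHom ℚ)))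
    (hφ' : Polynomial.eval₂ (Int.castRingHom (CategoryTheory.End A)) (φ' : CategoryTheory.End A) P' = 0)
    (hE : ∀ u : A ⟶ A, pullbackOne A u ∈ centralizerAlgebra A → pullbackOne A u ∈ Algebra.adjoin ℂ {pullbackOne A φ'})
    (hreal : ∀ ρ' : ℂ, Polynomial.eval₂ (Int.castRingHom ℂ) ρ' P' = 0 → ρ'.im = 0)
    (hPirr : Irreducible (P.map (Int.castRingHom ℚ)))
    (hφ : Polynomial.eval₂ (Int.castRingHom (CategoryTheory.End A)) (φ : CategoryTheory.End A) P = 0) (ρ : ℂ) :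
    eigenMultiplicity A φ ρ = eigenMultiplicity A φ (starRingEnd ℂ ρ) :=
  eigenMultiplicity_eq_of_center_le_adjoin hP'irr hφ' hE
    (fun ρ' hρ' => by rw [Complex.conj_eq_iff_im.2 (hreal ρ' hρ')]) hPirr hφ ρ

/-- **THE CASE `E = ℚ`: if every central pull-back is a SCALAR on `H¹(A(ℂ); ℂ)` (the centre of `End⁰(A)` is `ℚ` — e.g.
`End⁰(A) = ℚ`, or `A ∼ Yᵐ` with `Y` simple of type I, II or III with centre `ℚ`), then `n_ρ = n_ρ̄` for EVERY
`F = ℚ(φ) ⊆ End⁰(A)`, i.e. every `W_F` consists of Hodge classes** — Remark (1) with `F′ = ℚ = ℚ(𝟙)` (`P′ = T − 1`, whose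
only root `1` is real).  (`E = ℚ` is totally real: consistent with the second Remark, §E.)
[cite: MoonenZarhin1998WeilClasses, §1 Remark (1) after Criterion (2) (chunk p0004) and the second Remark after the Criterion (chunk p0002)] -/
theorem eigenMultiplicity_eq_of_center_scalar
    (hE : ∀ u : A ⟶ A, pullbackOne A u ∈ centralizerAlgebra A → ∃ c : ℂ, pullbackOne A u = c • 1)
    (hPirr : Irreducible (P.map (Int.castRingHom ℚ)))
    (hφ : Polynomial.eval₂ (Int.castRingHom (CategoryTheory.End A)) (φ : CategoryTheory.End A) P = 0) (ρ : ℂ) :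
    eigenMultiplicity A φ ρ = eigenMultiplicity A φ (starRingEnd ℂ ρ) := by
  -- `F′ = ℚ(𝟙 A)`, `P′ = T − 1`
  have hP'irr : Irreducible (((X : ℤ[X]) - 1).map (Int.castRingHom ℚ)) := by
    rw [Polynomial.map_sub, Polynomial.map_X, Polynomial.map_one, ← map_one (Polynomial.C : ℚ →+* ℚ[X])]
    exact Polynomial.irreducible_X_sub_C (1 : ℚ)
  have hφ' : Polynomial.eval₂ (Int.castRingHom (CategoryTheory.End A)) ((𝟙 A : A ⟶ A) : CategoryTheory.End A)
      ((X : ℤ[X]) - 1) = 0 := by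
    rw [Polynomial.eval₂_sub, Polynomial.eval₂_X, Polynomial.eval₂_one]
    exact sub_self _
  refine eigenMultiplicity_eq_of_center_le_adjoin_of_forall_root_im_eq_zero hP'irr hφ' (fun u huC => ?_)
    (fun ρ' hρ' => ?_) hPirr hφ ρ
  · obtain ⟨c, hc⟩ := hE u huC
    rw [hc]
    exact Subalgebra.smul_mem _ (Subalgebra.one_mem _) c
  · rw [Polynomial.eval₂_sub, Polynomial.eval₂_X, Polynomial.eval₂_one, sub_eq_zero] at hρ'
    rw [hρ', Complex.one_im]

/-- **… so for `E = ℚ` every `W_F ⊗ ℂ ≤ Bᵐ ⊗ ℂ`** (`P` monic irreducible of degree `e`, `P(φ) = 0`, `e · 2m = 2 dim A`).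
[cite: MoonenZarhin1998WeilClasses, §1 Remark (1) after Criterion (2) (chunk p0004) and the Criterion (chunk p0001)] -/
theorem weilClassesField_le_hodgeClassSpan_of_center_scalar
    (hE : ∀ u : A ⟶ A, pullbackOne A u ∈ centralizerAlgebra A → ∃ c : ℂ, pullbackOne A u = c • 1)
    (hPm : P.Monic) (hPe : P.natDegree = e) (hPirr : Irreducible (P.map (Int.castRingHom ℚ)))
    (hφ : Polynomial.eval₂ (Int.castRingHom (CategoryTheory.End A)) (φ : CategoryTheory.End A) P = 0)
    (her : e * (2 * m) = 2 * A.dim) :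
    weilClassesField A φ P (2 * m) ≤ hodgeClassSpan A.dim A.X m :=
  (Deligne1982.weilClassesField_le_hodgeClassSpan_iff_forall_eigenMultiplicity_eq hPm hPe hPirr hφ her).2
    fun ρ _ => eigenMultiplicity_eq_of_center_scalar hE hPirr hφ ρ

end CenterInSubfield

end Literature.AlgebraicGeometry.HodgeTheory

end
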